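import Literature.Barriers.RiemannHypothesis.MollifierLimitationsPropBResonant
import Literature.Barriers.RiemannHypothesis.MollifierLimitationsPropBAsymptoticProofs
import HarnessLib

/-!
# Radziwiłł 2012, Proposition B — discharged without the Balasubramanian–Conrey–Heath-Brown asymptotic

Last file of the BCH-free proof of `Literature.Barriers.RiemannHypothesis.Radziwill2012_propB`
(M. Radziwiłł, *Limitations to mollifying ζ(s)*, arXiv:1207.6583, Proposition B: for `0 < θ < ½`
and every mollifier `M_θ(s) = ∑_{n ≤ T^θ} a(n) n^{-s}`, `a(1) = 1`, `a(n) ≪ n^ε`,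
`𝓘(M_θ) = T⁻¹∫_T^{2T} |1 − ζM_θ|² ≥ 1/θ + o(1)`).

The printed route is `𝓘 ∼ 𝒬_T(a) − 1` (Balasubramanian–Conrey–Heath-Brown) and `𝒬_T(a) ≥ 1 + 1/θ + o(1)`
(Soundararajan, §7; the tree's `Radziwill2012_propB_quadForm_holds`). Only the LOWER bound is
needed, and it follows from first moments of `ζ` alone once the main part of the approximate
functional equation is smooth and self-dual (`SelfDualSmoothedAFE.lean`): with the smooth window
`w ≤ 𝟙_{[T,2T]}`, `f = 1 − ζM`, `g = 1 − VM`, `V = S + χS̄`, `E = ζ − V = O(T^{-1/4} log T)`,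

* `∫_T^{2T} |f|² ≥ ∫ w|f|² ≥ (1 − ε₃)∫ w|g|² − ε₃⁻¹ sup|E|² ∫ w|M|²`;
* `∫ w|g|² = W − 2Re ∫ wVM + ∫ w|V|²|M|²` and `|V|² = 2Re(V̄S)` (self-duality), so both remaining
  integrals are FIRST moments of `V = ζ − E`: `∫ w ζ M = W + o(T)` and
  `2Re ∫ w ζ S̄ |M|² = ∫ w(t) 𝒬_{et/4}(a) dt + o(T)` (parts D, E), while
  `𝒬_{et/4}(a) ≥ 1 + 1/θ + o(1)` pointwise (part C rescaled);
* all error terms are `O(T^{1 − (½ − θ)/4 + o(1)}) = o(T)` exactly because `θ < ½`.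

* `PropBFinal.numerics` — the real-inequality bookkeeping of the three displays;
* `Radziwill2012_propB_holds` — **the discharge**.

## References

* [Radziwill2012] M. Radziwiłł, *Limitations to mollifying ζ(s)*, arXiv:1207.6583 (2012), Prop. B, §7.
* [Titchmarsh1986] E. C. Titchmarsh, *The Theory of the Riemann Zeta-Function*, 2nd ed., Thm 4.13, §7.2.
-/

noncomputable section

open Complex MeasureTheory Set Filter Finset Real
open scoped Real Topology ComplexConjugate ContDiff

namespace Literature.Barriers.RiemannHypothesis

namespace PropBFinal


/-! ### Pointwise algebra -/

/-- Self-duality carried over to `|V|²|M|²`: if `‖V‖² = 2 Re(conj V · S)` then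
`‖V‖²‖M‖² = 2 Re(V conj S · M conj M)`. [folklore] -/
theorem normSq_mul_normSq_eq (V S M : ℂ) (hV : ‖V‖ ^ 2 = 2 * (conj V * S).re) :
    ‖V‖ ^ 2 * ‖M‖ ^ 2 = 2 * (V * conj S * M * conj M).re := by
  have h1 : (V * conj S * M * conj M).re = (conj V * S * (M * conj M)).re := by
    rw [← Complex.conj_re (V * conj S * M * conj M)]
    simp only [map_mul, Complex.conj_conj]
    ring_nf
  have him : (M * conj M).im = 0 := by rw [Complex.mul_conj]; simp
  have hre : (M * conj M).re = ‖M‖ ^ 2 := by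
    rw [Complex.mul_conj, ← Complex.normSq_eq_norm_sq]; simp
  have h2 : (conj V * S * (M * conj M)).re = (conj V * S).re * ‖M‖ ^ 2 := by
    rw [Complex.mul_re, him, hre]; ring
  rw [h1, h2, hV]; ring

/-- `‖g − d‖² ≥ ‖g‖² − ε‖g‖² − ε⁻¹‖d‖²` (`ε > 0`). [folklore] -/
theorem norm_sub_sq_ge (g d : ℂ) {ε : ℝ} (hε : 0 < ε) :
    ‖g‖ ^ 2 - ε * ‖g‖ ^ 2 - ε⁻¹ * ‖d‖ ^ 2 ≤ ‖g - d‖ ^ 2 := by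
  have h1 : |‖g‖ - ‖d‖| ≤ ‖g - d‖ := abs_norm_sub_norm_le g d
  have h3 : (‖g‖ - ‖d‖) ^ 2 ≤ ‖g - d‖ ^ 2 := by
    rw [← sq_abs (‖g‖ - ‖d‖)]
    exact pow_le_pow_left₀ (abs_nonneg _) h1 2
  have h2 := PropBMoments.mul_le_amgm ‖g‖ ‖d‖ hε
  nlinarith [h2, h3, norm_nonneg d, norm_nonneg g, sq_nonneg ‖d‖]

/-- `‖1 − VM‖² ≤ 2 + 8‖S‖²‖M‖²` when `‖V‖ ≤ 2‖S‖`. [folklore] -/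
theorem norm_one_sub_mul_sq_le (V S M : ℂ) (hV : ‖V‖ ≤ 2 * ‖S‖) :
    ‖1 - V * M‖ ^ 2 ≤ 2 + 8 * (‖S‖ ^ 2 * ‖M‖ ^ 2) := by
  have h1 : ‖1 - V * M‖ ≤ 1 + 2 * ‖S‖ * ‖M‖ := by
    calc ‖1 - V * M‖ ≤ ‖(1 : ℂ)‖ + ‖V * M‖ := norm_sub_le _ _
      _ = 1 + ‖V‖ * ‖M‖ := by rw [norm_one, norm_mul]
      _ ≤ 1 + 2 * ‖S‖ * ‖M‖ := by nlinarith [norm_nonneg M]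
  have h0 : 0 ≤ ‖1 - V * M‖ := norm_nonneg _
  have hSM : 0 ≤ ‖S‖ * ‖M‖ := by positivity
  nlinarith [h1, sq_nonneg (1 - 2 * ‖S‖ * ‖M‖)]

/-- `|Re(E M)| ≤ ‖E‖(1 + ‖M‖²)/2`. [folklore] -/
theorem abs_re_mul_le (E M : ℂ) : |(E * M).re| ≤ ‖E‖ * (1 + ‖M‖ ^ 2) / 2 := by
  have h1 : |(E * M).re| ≤ ‖E‖ * ‖M‖ := by
    rw [← norm_mul]; exact Complex.abs_re_le_norm _
  have h2 : ‖M‖ ≤ (1 + ‖M‖ ^ 2) / 2 := by nlinarith [sq_nonneg (‖M‖ - 1)]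
  calc |(E * M).re| ≤ ‖E‖ * ‖M‖ := h1
    _ ≤ ‖E‖ * ((1 + ‖M‖ ^ 2) / 2) := mul_le_mul_of_nonneg_left h2 (norm_nonneg _)
    _ = _ := by ring

/-- `|Re(E conj S · M conj M)| ≤ ‖E‖ (ε ‖S M‖² + ε⁻¹ ‖M‖²)/2` (`ε > 0`). [folklore] -/
theorem abs_re_ESMM_le (E S M : ℂ) {ε : ℝ} (hε : 0 < ε) :
    |(E * conj S * M * conj M).re| ≤ ‖E‖ * (ε * ‖S * M‖ ^ 2 + ε⁻¹ * ‖M‖ ^ 2) / 2 := by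
  have h1 : |(E * conj S * M * conj M).re| ≤ ‖E‖ * (‖S * M‖ * ‖M‖) := by
    calc |(E * conj S * M * conj M).re| ≤ ‖E * conj S * M * conj M‖ := Complex.abs_re_le_norm _
      _ = ‖E‖ * (‖S * M‖ * ‖M‖) := by
          simp only [norm_mul, Complex.norm_conj]; ring
  have h2 := PropBMoments.mul_le_amgm ‖S * M‖ ‖M‖ hε
  calc |(E * conj S * M * conj M).re| ≤ ‖E‖ * (‖S * M‖ * ‖M‖) := h1
    _ ≤ ‖E‖ * ((ε * ‖S * M‖ ^ 2 + ε⁻¹ * ‖M‖ ^ 2) / 2) := mul_le_mul_of_nonneg_left h2 (norm_nonneg _)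
    _ = _ := by ring


/-! ### Continuity and integrability on the window -/

open Literature.Analysis.Fourier Literature.NumberTheory.LFunctions
open Literature.NumberTheory.LFunctions.SelfDualAFE
open PropBMoments PropBResonant

/-- `χ(1/2+it)` is continuous in `t` (`χ = e^{-2iϑ}`, `ϑ` differentiable). [folklore] -/
theorem continuous_chi_half : Continuous fun t : ℝ => riemannZetaChi (1 / 2 + t * I) := by
  have hθ : Continuous riemannSiegelTheta :=
    continuous_iff_continuousAt.2 fun t => (hasDerivAt_riemannSiegelTheta_holds t).continuousAt
  have : (fun t : ℝ => riemannZetaChi (1 / 2 + t * I))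
      = fun t : ℝ => cexp (-(2 * (riemannSiegelTheta t : ℂ) * I)) := funext riemannZetaChi_half_eq_cexp
  rw [this]
  fun_prop

/-- The smoothed main sum is continuous on `t > 0`. [folklore] -/
theorem continuousOn_mainSum {κ : ℝ} (hκ : 0 < κ) (Ns : ℕ) :
    ContinuousOn (fun t : ℝ => mainSum κ Ns t) (Set.Ioi 0) := by
  have : (fun t : ℝ => mainSum κ Ns t) = fun t : ℝ => ∑ n ∈ Finset.Icc 1 Ns,
      ((weight κ n t : ℝ) : ℂ) * (n : ℂ) ^ (-(1 / 2 : ℂ) - t * I) := funext fun t => mainSum_def κ Ns t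
  rw [this]
  refine continuousOn_finsetSum _ fun n hn => ?_
  have hn1 := (Finset.mem_Icc.1 hn).1
  refine (Complex.continuous_ofReal.comp_continuousOn (continuousOn_weight hκ hn1)).mul ?_
  have : (fun t : ℝ => (n : ℂ) ^ (-(1 / 2 : ℂ) - t * I)) = fun t : ℝ =>
      (((n : ℝ) ^ (-(1 / 2 : ℝ)) : ℝ) : ℂ) * cexp (I * ((-Real.log n : ℝ) : ℂ) * (t : ℂ)) := by
    funext t
    have := mollifier_term_eq hn1 (fun _ => (1 : ℂ)) t
    simp only [one_mul] at this
    rw [show (-(1 / 2 : ℂ) - t * I) = -(1 / 2 + t * I) by ring, this]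
  rw [this]
  exact Continuous.continuousOn (by fun_prop)

/-- The self-dual main part is continuous on `t > 0`. [folklore] -/
theorem continuousOn_sdAFE {κ : ℝ} (hκ : 0 < κ) (Ns : ℕ) :
    ContinuousOn (fun t : ℝ => sdAFE κ Ns t) (Set.Ioi 0) := by
  have h1 := continuousOn_mainSum hκ Ns
  have : (fun t : ℝ => sdAFE κ Ns t) = fun t => mainSum κ Ns t
      + riemannZetaChi (1 / 2 + t * I) * conj (mainSum κ Ns t) := funext fun t => sdAFE_def κ Ns t
  rw [this]
  exact h1.add (continuous_chi_half.continuousOn.mul (Complex.continuous_conj.comp_continuousOn h1))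

/-- Integrability of `w F` for `F` continuous on `[T, 2T]` (complex-valued; `0 < H ≤ T`). [folklore] -/
theorem integrable_w_mul_of_continuousOn {T H : ℝ} (hH : 0 < H) (hHT : H ≤ T) {F : ℝ → ℂ}
    (hF : ContinuousOn F (Set.Icc T (2 * T))) : Integrable (fun t => dyadicWindow T H t * F t) := by
  have heq : (fun t => dyadicWindow T H t * F t)
      = (Set.Icc T (2 * T)).indicator (fun t => dyadicWindow T H t * F t) := by
    funext t
    by_cases ht : t ∈ Set.Icc T (2 * T)
    · rw [Set.indicator_of_mem ht]
    · rw [Set.indicator_of_notMem ht]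
      have : dyadicWindow T H t = 0 := by
        by_contra h
        exact ht (support_dyadicWindow_subset hH hHT (Function.mem_support.2 h))
      rw [this, zero_mul]
  rw [heq, integrable_indicator_iff measurableSet_Icc]
  exact ((continuous_dyadicWindow T H).continuousOn.mul hF).integrableOn_Icc

/-- `(∫ w F).re = ∫ w_re · Re F` for `F` continuous on `[T, 2T]`. [folklore] -/
theorem re_integral_w_mul {T H : ℝ} (hH : 0 < H) (hHT : H ≤ T) {F : ℝ → ℂ}
    (hF : ContinuousOn F (Set.Icc T (2 * T))) :
    (∫ t, dyadicWindow T H t * F t).re = ∫ t, dyadicWindowRe T H t * (F t).re := by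
  have h := integral_re (integrable_w_mul_of_continuousOn hH hHT hF)
  simp only [RCLike.re_to_complex] at h
  rw [← h]
  refine integral_congr_ae (Filter.Eventually.of_forall fun t => ?_)
  show (dyadicWindow T H t * F t).re = dyadicWindowRe T H t * (F t).re
  rw [dyadicWindow_eq_ofReal, Complex.re_ofReal_mul]

/-- Monotonicity of the window integral for pointwise inequalities on `[T, 2T]`: if `F ≤ G` there
and both `w F`, `w G` are integrable then `∫ w F ≤ ∫ w G` (`0 < H ≤ T`). [folklore] -/
theorem integral_wre_mono {T H : ℝ} (hH : 0 < H) (hHT : H ≤ T) {F G : ℝ → ℝ}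
    (hF : Integrable fun t => dyadicWindowRe T H t * F t) (hG : Integrable fun t => dyadicWindowRe T H t * G t)
    (hle : ∀ t ∈ Set.Icc T (2 * T), F t ≤ G t) :
    ∫ t, dyadicWindowRe T H t * F t ≤ ∫ t, dyadicWindowRe T H t * G t := by
  refine integral_mono hF hG fun t => ?_
  by_cases ht : t ∈ Set.Icc T (2 * T)
  · exact mul_le_mul_of_nonneg_left (hle t ht) (dyadicWindowRe_mem_Icc hH hHT t).1
  · simp only [dyadicWindowRe_eq_zero hH hHT ht, zero_mul, le_refl]


/-! ### The integrated pointwise facts -/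

/-- Continuity package on `[T, 2T]` (`T > 0`). [folklore] -/
theorem continuousOn_players (a : ℕ → ℂ) (N Ns : ℕ) {κ : ℝ} (hκ : 0 < κ) {T : ℝ} (hT : 0 < T) :
    ContinuousOn (fun t : ℝ => riemannZeta (1 / 2 + t * I)) (Set.Icc T (2 * T))
    ∧ ContinuousOn (fun t : ℝ => Mt a N t) (Set.Icc T (2 * T))
    ∧ ContinuousOn (fun t : ℝ => mainSum κ Ns t) (Set.Icc T (2 * T))
    ∧ ContinuousOn (fun t : ℝ => sdAFE κ Ns t) (Set.Icc T (2 * T)) := by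
  have hsub : Set.Icc T (2 * T) ⊆ Set.Ioi 0 := fun t ht => Set.mem_Ioi.2 (hT.trans_le ht.1)
  exact ⟨continuous_zeta_half_line.continuousOn, (continuous_Mt a N).continuousOn,
    (continuousOn_mainSum hκ Ns).mono hsub, (continuousOn_sdAFE hκ Ns).mono hsub⟩

/-- **The identity for `∫ w |g|²`** (`g = 1 − VM`, `V = S + χS̄` self-dual, `E = ζ − V`):
`∫ w|g|² = W − 2(Re∫wζM − Re∫wEM) + 2(Re∫wζS̄MM̄ − Re∫wES̄MM̄)`. [folklore] -/
theorem integral_normSq_g_eq (a : ℕ → ℂ) (N Ns : ℕ) {κ : ℝ} (hκ : 0 < κ) {T H : ℝ} (hH : 0 < H) (hHT : H ≤ T) :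
    ∫ t, dyadicWindowRe T H t * ‖1 - sdAFE κ Ns t * Mt a N t‖ ^ 2
      = (∫ t, dyadicWindowRe T H t)
        - 2 * ((∫ t, dyadicWindow T H t * (riemannZeta (1 / 2 + t * I) * Mt a N t)).re
              - (∫ t, dyadicWindow T H t * ((riemannZeta (1 / 2 + t * I) - sdAFE κ Ns t) * Mt a N t)).re)
        + 2 * ((∫ t, dyadicWindow T H t * (riemannZeta (1 / 2 + t * I) * conj (mainSum κ Ns t)
                  * Mt a N t * conj (Mt a N t))).re
              - (∫ t, dyadicWindow T H t * ((riemannZeta (1 / 2 + t * I) - sdAFE κ Ns t)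
                  * conj (mainSum κ Ns t) * Mt a N t * conj (Mt a N t))).re) := by
  have hT : 0 < T := hH.trans_le hHT
  obtain ⟨cζ, cM, cS, cV⟩ := continuousOn_players a N Ns hκ hT
  set wre := dyadicWindowRe T H with hwre
  set Z : ℝ → ℂ := fun t => riemannZeta (1 / 2 + t * I) with hZ
  set V : ℝ → ℂ := fun t => sdAFE κ Ns t with hV
  set S : ℝ → ℂ := fun t => mainSum κ Ns t with hS
  set M : ℝ → ℂ := fun t => Mt a N t with hM
  have cE : ContinuousOn (fun t => Z t - V t) (Set.Icc T (2 * T)) := cζ.sub cV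
  have cSb : ContinuousOn (fun t => conj (S t)) (Set.Icc T (2 * T)) := Complex.continuous_conj.comp_continuousOn cS
  have cMb : ContinuousOn (fun t => conj (M t)) (Set.Icc T (2 * T)) := Complex.continuous_conj.comp_continuousOn cM
  -- the four real integrals as complex ones
  have r1 : (∫ t, dyadicWindow T H t * (Z t * M t)).re = ∫ t, wre t * (Z t * M t).re :=
    re_integral_w_mul hH hHT (cζ.mul cM)
  have r2 : (∫ t, dyadicWindow T H t * ((Z t - V t) * M t)).re = ∫ t, wre t * ((Z t - V t) * M t).re :=
    re_integral_w_mul hH hHT (cE.mul cM)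
  have r3 : (∫ t, dyadicWindow T H t * (Z t * conj (S t) * M t * conj (M t))).re
      = ∫ t, wre t * (Z t * conj (S t) * M t * conj (M t)).re :=
    re_integral_w_mul hH hHT (((cζ.mul cSb).mul cM).mul cMb)
  have r4 : (∫ t, dyadicWindow T H t * ((Z t - V t) * conj (S t) * M t * conj (M t))).re
      = ∫ t, wre t * ((Z t - V t) * conj (S t) * M t * conj (M t)).re :=
    re_integral_w_mul hH hHT (((cE.mul cSb).mul cM).mul cMb)
  show ∫ t, wre t * ‖1 - V t * M t‖ ^ 2 = (∫ t, wre t)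
    - 2 * ((∫ t, dyadicWindow T H t * (Z t * M t)).re - (∫ t, dyadicWindow T H t * ((Z t - V t) * M t)).re)
    + 2 * ((∫ t, dyadicWindow T H t * (Z t * conj (S t) * M t * conj (M t))).re
      - (∫ t, dyadicWindow T H t * ((Z t - V t) * conj (S t) * M t * conj (M t))).re)
  rw [r1, r2, r3, r4]
  -- pointwise identity
  have hpt : ∀ t, ‖1 - V t * M t‖ ^ 2 = 1 - 2 * ((Z t * M t).re - ((Z t - V t) * M t).re)
      + 2 * ((Z t * conj (S t) * M t * conj (M t)).re - ((Z t - V t) * conj (S t) * M t * conj (M t)).re) := by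
    intro t
    have hVS : ‖V t‖ ^ 2 = 2 * (conj (V t) * S t).re := normSq_sdAFE (SelfDualAFE.norm_riemannZetaChi_half t)
    have h1 := PropBAsymptotic.norm_one_sub_sq (V t * M t)
    have h2 := normSq_mul_normSq_eq (V t) (S t) (M t) hVS
    rw [h1, norm_mul, mul_pow, h2]
    have e1 : (Z t * M t).re - ((Z t - V t) * M t).re = (V t * M t).re := by
      rw [← Complex.sub_re]; congr 1; ring
    have e2 : (Z t * conj (S t) * M t * conj (M t)).re - ((Z t - V t) * conj (S t) * M t * conj (M t)).re
        = (V t * conj (S t) * M t * conj (M t)).re := by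
      rw [← Complex.sub_re]; congr 1; ring
    rw [e1, e2]
  -- integrability
  have iζM : Integrable fun t => wre t * (Z t * M t).re :=
    integrable_wre_mul_of_continuousOn hH hHT (Complex.continuous_re.comp_continuousOn (cζ.mul cM))
  have iEM : Integrable fun t => wre t * ((Z t - V t) * M t).re :=
    integrable_wre_mul_of_continuousOn hH hHT (Complex.continuous_re.comp_continuousOn (cE.mul cM))
  have iζS : Integrable fun t => wre t * (Z t * conj (S t) * M t * conj (M t)).re :=
    integrable_wre_mul_of_continuousOn hH hHT (Complex.continuous_re.comp_continuousOn (((cζ.mul cSb).mul cM).mul cMb))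
  have iES : Integrable fun t => wre t * ((Z t - V t) * conj (S t) * M t * conj (M t)).re :=
    integrable_wre_mul_of_continuousOn hH hHT (Complex.continuous_re.comp_continuousOn (((cE.mul cSb).mul cM).mul cMb))
  have iW : Integrable wre := by
    have := integrable_wre_mul_of_continuousOn hH hHT (F := fun _ => (1 : ℝ)) continuousOn_const
    simpa using this
  have heq : (fun t => wre t * ‖1 - V t * M t‖ ^ 2) = fun t => wre t
      - 2 * (wre t * (Z t * M t).re - wre t * ((Z t - V t) * M t).re)
      + 2 * (wre t * (Z t * conj (S t) * M t * conj (M t)).re - wre t * ((Z t - V t) * conj (S t) * M t * conj (M t)).re) := by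
    funext t; rw [hpt t]; ring
  have i4 : Integrable (fun t => wre t * (Z t * M t).re - wre t * ((Z t - V t) * M t).re) := iζM.sub iEM
  have i5 : Integrable (fun t => wre t * (Z t * conj (S t) * M t * conj (M t)).re
      - wre t * ((Z t - V t) * conj (S t) * M t * conj (M t)).re) := iζS.sub iES
  have i3 : Integrable (fun t => 2 * (wre t * (Z t * M t).re - wre t * ((Z t - V t) * M t).re)) := i4.const_mul 2
  have i2 : Integrable (fun t => 2 * (wre t * (Z t * conj (S t) * M t * conj (M t)).re
      - wre t * ((Z t - V t) * conj (S t) * M t * conj (M t)).re)) := i5.const_mul 2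
  have i1 : Integrable (fun t => wre t - 2 * (wre t * (Z t * M t).re - wre t * ((Z t - V t) * M t).re)) := iW.sub i3
  rw [heq, integral_add i1 i2, integral_sub iW i3, MeasureTheory.integral_const_mul,
    MeasureTheory.integral_const_mul, integral_sub iζM iEM, integral_sub iζS iES]

/-- **`∫ w|f|² ≥ ∫ w|g|² − ε₃ ∫ w|g|² − ε₃⁻¹ sup|E|² ∫ w|M|²`** (`f = 1 − ζM = g − EM`). [folklore] -/
theorem integral_normSq_f_ge (a : ℕ → ℂ) (N Ns : ℕ) {κ : ℝ} (hκ : 0 < κ) {T H : ℝ} (hH : 0 < H) (hHT : H ≤ T)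
    {ε₃ supE : ℝ} (hε₃ : 0 < ε₃)
    (hE : ∀ t ∈ Set.Icc T (2 * T), ‖riemannZeta (1 / 2 + t * I) - sdAFE κ Ns t‖ ≤ supE) :
    (∫ t, dyadicWindowRe T H t * ‖1 - sdAFE κ Ns t * Mt a N t‖ ^ 2)
        - ε₃ * (∫ t, dyadicWindowRe T H t * ‖1 - sdAFE κ Ns t * Mt a N t‖ ^ 2)
        - ε₃⁻¹ * (supE ^ 2 * ∫ t, dyadicWindowRe T H t * ‖Mt a N t‖ ^ 2)
      ≤ ∫ t, dyadicWindowRe T H t * ‖1 - riemannZeta (1 / 2 + t * I) * Mt a N t‖ ^ 2 := by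
  have hT : 0 < T := hH.trans_le hHT
  obtain ⟨cζ, cM, cS, cV⟩ := continuousOn_players a N Ns hκ hT
  have cg : ContinuousOn (fun t => ‖1 - sdAFE κ Ns t * Mt a N t‖ ^ 2) (Set.Icc T (2 * T)) :=
    ((continuousOn_const.sub (cV.mul cM)).norm).pow 2
  have cf : ContinuousOn (fun t : ℝ => ‖1 - riemannZeta (1 / 2 + t * I) * Mt a N t‖ ^ 2) (Set.Icc T (2 * T)) :=
    ((continuousOn_const.sub (cζ.mul cM)).norm).pow 2
  have cM2 : ContinuousOn (fun t => ‖Mt a N t‖ ^ 2) (Set.Icc T (2 * T)) := (cM.norm).pow 2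
  have ig := integrable_wre_mul_of_continuousOn hH hHT cg
  have iff := integrable_wre_mul_of_continuousOn hH hHT cf
  have iM := integrable_wre_mul_of_continuousOn hH hHT cM2
  have hle : ∀ t ∈ Set.Icc T (2 * T),
      (‖1 - sdAFE κ Ns t * Mt a N t‖ ^ 2 - ε₃ * ‖1 - sdAFE κ Ns t * Mt a N t‖ ^ 2
        - ε₃⁻¹ * (supE ^ 2 * ‖Mt a N t‖ ^ 2)) ≤ ‖1 - riemannZeta (1 / 2 + t * I) * Mt a N t‖ ^ 2 := by
    intro t ht
    have h1 := norm_sub_sq_ge (1 - sdAFE κ Ns t * Mt a N t)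
      ((riemannZeta (1 / 2 + t * I) - sdAFE κ Ns t) * Mt a N t) hε₃
    have e : 1 - sdAFE κ Ns t * Mt a N t - (riemannZeta (1 / 2 + t * I) - sdAFE κ Ns t) * Mt a N t
        = 1 - riemannZeta (1 / 2 + t * I) * Mt a N t := by ring
    rw [e] at h1
    have h2 : ‖(riemannZeta (1 / 2 + t * I) - sdAFE κ Ns t) * Mt a N t‖ ^ 2 ≤ supE ^ 2 * ‖Mt a N t‖ ^ 2 := by
      rw [norm_mul, mul_pow]
      exact mul_le_mul_of_nonneg_right (pow_le_pow_left₀ (norm_nonneg _) (hE t ht) 2) (sq_nonneg _)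
    have h3 : ε₃⁻¹ * ‖(riemannZeta (1 / 2 + t * I) - sdAFE κ Ns t) * Mt a N t‖ ^ 2 ≤ ε₃⁻¹ * (supE ^ 2 * ‖Mt a N t‖ ^ 2) :=
      mul_le_mul_of_nonneg_left h2 (inv_nonneg.2 hε₃.le)
    linarith
  have ilhs : Integrable fun t => dyadicWindowRe T H t * (‖1 - sdAFE κ Ns t * Mt a N t‖ ^ 2
      - ε₃ * ‖1 - sdAFE κ Ns t * Mt a N t‖ ^ 2 - ε₃⁻¹ * (supE ^ 2 * ‖Mt a N t‖ ^ 2)) := by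
    have : (fun t => dyadicWindowRe T H t * (‖1 - sdAFE κ Ns t * Mt a N t‖ ^ 2
        - ε₃ * ‖1 - sdAFE κ Ns t * Mt a N t‖ ^ 2 - ε₃⁻¹ * (supE ^ 2 * ‖Mt a N t‖ ^ 2)))
        = fun t => dyadicWindowRe T H t * ‖1 - sdAFE κ Ns t * Mt a N t‖ ^ 2
          - ε₃ * (dyadicWindowRe T H t * ‖1 - sdAFE κ Ns t * Mt a N t‖ ^ 2)
          - ε₃⁻¹ * supE ^ 2 * (dyadicWindowRe T H t * ‖Mt a N t‖ ^ 2) := by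
      funext t; ring
    rw [this]
    exact (ig.sub (ig.const_mul _)).sub (iM.const_mul _)
  have hmono := integral_wre_mono hH hHT ilhs iff hle
  have hsplit : ∫ t, dyadicWindowRe T H t * (‖1 - sdAFE κ Ns t * Mt a N t‖ ^ 2
      - ε₃ * ‖1 - sdAFE κ Ns t * Mt a N t‖ ^ 2 - ε₃⁻¹ * (supE ^ 2 * ‖Mt a N t‖ ^ 2))
      = (∫ t, dyadicWindowRe T H t * ‖1 - sdAFE κ Ns t * Mt a N t‖ ^ 2)
        - ε₃ * (∫ t, dyadicWindowRe T H t * ‖1 - sdAFE κ Ns t * Mt a N t‖ ^ 2)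
        - ε₃⁻¹ * (supE ^ 2 * ∫ t, dyadicWindowRe T H t * ‖Mt a N t‖ ^ 2) := by
    have : (fun t => dyadicWindowRe T H t * (‖1 - sdAFE κ Ns t * Mt a N t‖ ^ 2
        - ε₃ * ‖1 - sdAFE κ Ns t * Mt a N t‖ ^ 2 - ε₃⁻¹ * (supE ^ 2 * ‖Mt a N t‖ ^ 2)))
        = fun t => dyadicWindowRe T H t * ‖1 - sdAFE κ Ns t * Mt a N t‖ ^ 2
          - ε₃ * (dyadicWindowRe T H t * ‖1 - sdAFE κ Ns t * Mt a N t‖ ^ 2)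
          - ε₃⁻¹ * supE ^ 2 * (dyadicWindowRe T H t * ‖Mt a N t‖ ^ 2) := by
      funext t; ring
    have i1 : Integrable (fun t => dyadicWindowRe T H t * ‖1 - sdAFE κ Ns t * Mt a N t‖ ^ 2
        - ε₃ * (dyadicWindowRe T H t * ‖1 - sdAFE κ Ns t * Mt a N t‖ ^ 2)) := ig.sub (ig.const_mul ε₃)
    have i2 : Integrable (fun t => ε₃⁻¹ * supE ^ 2 * (dyadicWindowRe T H t * ‖Mt a N t‖ ^ 2)) :=
      iM.const_mul (ε₃⁻¹ * supE ^ 2)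
    have i3 : Integrable (fun t => ε₃ * (dyadicWindowRe T H t * ‖1 - sdAFE κ Ns t * Mt a N t‖ ^ 2)) := ig.const_mul ε₃
    rw [this, integral_sub i1 i2, integral_sub ig i3, MeasureTheory.integral_const_mul, MeasureTheory.integral_const_mul]
    ring
  rw [← hsplit]
  exact hmono

/-- **`∫ w|g|² ≤ 2W + 8 ∫ w|SM|²`** (`‖V‖ ≤ 2‖S‖`). [folklore] -/
theorem integral_normSq_g_le (a : ℕ → ℂ) (N Ns : ℕ) {κ : ℝ} (hκ : 0 < κ) {T H : ℝ} (hH : 0 < H) (hHT : H ≤ T) :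
    ∫ t, dyadicWindowRe T H t * ‖1 - sdAFE κ Ns t * Mt a N t‖ ^ 2
      ≤ 2 * (∫ t, dyadicWindowRe T H t) + 8 * ∫ t, dyadicWindowRe T H t * ‖mainSum κ Ns t * Mt a N t‖ ^ 2 := by
  have hT : 0 < T := hH.trans_le hHT
  obtain ⟨cζ, cM, cS, cV⟩ := continuousOn_players a N Ns hκ hT
  have cg : ContinuousOn (fun t => ‖1 - sdAFE κ Ns t * Mt a N t‖ ^ 2) (Set.Icc T (2 * T)) :=
    ((continuousOn_const.sub (cV.mul cM)).norm).pow 2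
  have cSM : ContinuousOn (fun t => ‖mainSum κ Ns t * Mt a N t‖ ^ 2) (Set.Icc T (2 * T)) := ((cS.mul cM).norm).pow 2
  have ig := integrable_wre_mul_of_continuousOn hH hHT cg
  have iSM := integrable_wre_mul_of_continuousOn hH hHT cSM
  have iW : Integrable (dyadicWindowRe T H) := by
    have := integrable_wre_mul_of_continuousOn hH hHT (F := fun _ => (1 : ℝ)) continuousOn_const
    simpa using this
  have hle : ∀ t ∈ Set.Icc T (2 * T), ‖1 - sdAFE κ Ns t * Mt a N t‖ ^ 2 ≤ 2 + 8 * ‖mainSum κ Ns t * Mt a N t‖ ^ 2 := by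
    intro t _
    have hV : ‖sdAFE κ Ns t‖ ≤ 2 * ‖mainSum κ Ns t‖ := by
      rw [sdAFE_def]
      calc ‖mainSum κ Ns t + riemannZetaChi (1 / 2 + t * I) * conj (mainSum κ Ns t)‖
          ≤ ‖mainSum κ Ns t‖ + ‖riemannZetaChi (1 / 2 + t * I) * conj (mainSum κ Ns t)‖ := norm_add_le _ _
        _ = 2 * ‖mainSum κ Ns t‖ := by rw [norm_mul, SelfDualAFE.norm_riemannZetaChi_half, Complex.norm_conj]; ring
    have := norm_one_sub_mul_sq_le (sdAFE κ Ns t) (mainSum κ Ns t) (Mt a N t) hV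
    rw [norm_mul, mul_pow]; linarith
  have irhs : Integrable fun t => dyadicWindowRe T H t * (2 + 8 * ‖mainSum κ Ns t * Mt a N t‖ ^ 2) := by
    have : (fun t => dyadicWindowRe T H t * (2 + 8 * ‖mainSum κ Ns t * Mt a N t‖ ^ 2))
        = fun t => 2 * dyadicWindowRe T H t + 8 * (dyadicWindowRe T H t * ‖mainSum κ Ns t * Mt a N t‖ ^ 2) := by
      funext t; ring
    rw [this]; exact (iW.const_mul 2).add (iSM.const_mul 8)
  have hmono := integral_wre_mono hH hHT ig irhs hle
  have heq : ∫ t, dyadicWindowRe T H t * (2 + 8 * ‖mainSum κ Ns t * Mt a N t‖ ^ 2)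
      = 2 * (∫ t, dyadicWindowRe T H t) + 8 * ∫ t, dyadicWindowRe T H t * ‖mainSum κ Ns t * Mt a N t‖ ^ 2 := by
    have : (fun t => dyadicWindowRe T H t * (2 + 8 * ‖mainSum κ Ns t * Mt a N t‖ ^ 2))
        = fun t => 2 * dyadicWindowRe T H t + 8 * (dyadicWindowRe T H t * ‖mainSum κ Ns t * Mt a N t‖ ^ 2) := by
      funext t; ring
    have i1 : Integrable (fun t => 2 * dyadicWindowRe T H t) := iW.const_mul 2
    have i2 : Integrable (fun t => 8 * (dyadicWindowRe T H t * ‖mainSum κ Ns t * Mt a N t‖ ^ 2)) := iSM.const_mul 8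
    rw [this, integral_add i1 i2, MeasureTheory.integral_const_mul, MeasureTheory.integral_const_mul]
  rw [← heq]; exact hmono

/-- Bounding the real part of a window integral by a pointwise bound on `[T, 2T]`. [folklore] -/
theorem abs_re_integral_w_le {T H : ℝ} (hH : 0 < H) (hHT : H ≤ T) {F : ℝ → ℂ} {G : ℝ → ℝ}
    (hF : ContinuousOn F (Set.Icc T (2 * T))) (hG : ContinuousOn G (Set.Icc T (2 * T)))
    (hle : ∀ t ∈ Set.Icc T (2 * T), |(F t).re| ≤ G t) :
    |(∫ t, dyadicWindow T H t * F t).re| ≤ ∫ t, dyadicWindowRe T H t * G t := by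
  rw [re_integral_w_mul hH hHT hF]
  have i1 := integrable_wre_mul_of_continuousOn hH hHT (Complex.continuous_re.comp_continuousOn hF)
  have i2 := integrable_wre_mul_of_continuousOn hH hHT hG
  calc |∫ t, dyadicWindowRe T H t * (F t).re| ≤ ∫ t, |dyadicWindowRe T H t * (F t).re| := abs_integral_le_integral_abs
    _ ≤ ∫ t, dyadicWindowRe T H t * G t := by
        refine integral_mono i1.abs i2 fun t => ?_
        by_cases ht : t ∈ Set.Icc T (2 * T)
        · have hw := (dyadicWindowRe_mem_Icc hH hHT t).1
          rw [abs_mul, abs_of_nonneg hw]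
          exact mul_le_mul_of_nonneg_left (hle t ht) hw
        · simp only [dyadicWindowRe_eq_zero hH hHT ht, zero_mul, abs_zero, le_refl]

/-- **`|Re ∫ w E M| ≤ sup|E| (W + ∫ w|M|²)/2`.** [folklore] -/
theorem abs_re_integral_EM_le (a : ℕ → ℂ) (N Ns : ℕ) {κ : ℝ} (hκ : 0 < κ) {T H : ℝ} (hH : 0 < H) (hHT : H ≤ T)
    {supE : ℝ}
    (hE : ∀ t ∈ Set.Icc T (2 * T), ‖riemannZeta (1 / 2 + t * I) - sdAFE κ Ns t‖ ≤ supE) :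
    |(∫ t, dyadicWindow T H t * ((riemannZeta (1 / 2 + t * I) - sdAFE κ Ns t) * Mt a N t)).re|
      ≤ supE * ((∫ t, dyadicWindowRe T H t) + ∫ t, dyadicWindowRe T H t * ‖Mt a N t‖ ^ 2) / 2 := by
  have hT : 0 < T := hH.trans_le hHT
  obtain ⟨cζ, cM, cS, cV⟩ := continuousOn_players a N Ns hκ hT
  have cM2 : ContinuousOn (fun t => supE * (1 + ‖Mt a N t‖ ^ 2) / 2) (Set.Icc T (2 * T)) :=
    (continuousOn_const.mul (continuousOn_const.add ((cM.norm).pow 2))).div_const _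
  have h := abs_re_integral_w_le hH hHT ((cζ.sub cV).mul cM) cM2 (fun t ht => by
    refine (abs_re_mul_le _ _).trans ?_
    exact div_le_div_of_nonneg_right (mul_le_mul_of_nonneg_right (hE t ht) (by positivity)) (by norm_num))
  refine h.trans (le_of_eq ?_)
  have iW : Integrable (dyadicWindowRe T H) := by
    have := integrable_wre_mul_of_continuousOn hH hHT (F := fun _ => (1 : ℝ)) continuousOn_const
    simpa using this
  have cMn : ContinuousOn (fun t => ‖Mt a N t‖ ^ 2) (Set.Icc T (2 * T)) := (cM.norm).pow 2
  have iM := integrable_wre_mul_of_continuousOn hH hHT cMn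
  have : (fun t => dyadicWindowRe T H t * (supE * (1 + ‖Mt a N t‖ ^ 2) / 2))
      = fun t => (supE / 2) * dyadicWindowRe T H t + (supE / 2) * (dyadicWindowRe T H t * ‖Mt a N t‖ ^ 2) := by
    funext t; ring
  have i1 : Integrable (fun t => (supE / 2) * dyadicWindowRe T H t) := iW.const_mul _
  have i2 : Integrable (fun t => (supE / 2) * (dyadicWindowRe T H t * ‖Mt a N t‖ ^ 2)) := iM.const_mul _
  rw [this, integral_add i1 i2, MeasureTheory.integral_const_mul, MeasureTheory.integral_const_mul]
  ring

/-- **`|Re ∫ w E S̄ M M̄| ≤ sup|E| (ε₂ ∫ w|SM|² + ε₂⁻¹ ∫ w|M|²)/2`.** [folklore] -/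
theorem abs_re_integral_ESMM_le (a : ℕ → ℂ) (N Ns : ℕ) {κ : ℝ} (hκ : 0 < κ) {T H : ℝ} (hH : 0 < H) (hHT : H ≤ T)
    {supE ε₂ : ℝ} (hε₂ : 0 < ε₂)
    (hE : ∀ t ∈ Set.Icc T (2 * T), ‖riemannZeta (1 / 2 + t * I) - sdAFE κ Ns t‖ ≤ supE) :
    |(∫ t, dyadicWindow T H t * ((riemannZeta (1 / 2 + t * I) - sdAFE κ Ns t)
        * conj (mainSum κ Ns t) * Mt a N t * conj (Mt a N t))).re|
      ≤ supE * (ε₂ * (∫ t, dyadicWindowRe T H t * ‖mainSum κ Ns t * Mt a N t‖ ^ 2)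
          + ε₂⁻¹ * (∫ t, dyadicWindowRe T H t * ‖Mt a N t‖ ^ 2)) / 2 := by
  have hT : 0 < T := hH.trans_le hHT
  obtain ⟨cζ, cM, cS, cV⟩ := continuousOn_players a N Ns hκ hT
  have cSb : ContinuousOn (fun t => conj (mainSum κ Ns t)) (Set.Icc T (2 * T)) := Complex.continuous_conj.comp_continuousOn cS
  have cMb : ContinuousOn (fun t => conj (Mt a N t)) (Set.Icc T (2 * T)) := Complex.continuous_conj.comp_continuousOn cM
  have cG : ContinuousOn (fun t => supE * (ε₂ * ‖mainSum κ Ns t * Mt a N t‖ ^ 2 + ε₂⁻¹ * ‖Mt a N t‖ ^ 2) / 2)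
      (Set.Icc T (2 * T)) :=
    (continuousOn_const.mul ((continuousOn_const.mul (((cS.mul cM).norm).pow 2)).add
      (continuousOn_const.mul ((cM.norm).pow 2)))).div_const _
  have h := abs_re_integral_w_le hH hHT ((((cζ.sub cV).mul cSb).mul cM).mul cMb) cG (fun t ht => by
    refine (abs_re_ESMM_le _ _ _ hε₂).trans ?_
    exact div_le_div_of_nonneg_right (mul_le_mul_of_nonneg_right (hE t ht) (by positivity)) (by norm_num))
  refine h.trans (le_of_eq ?_)
  have cSMn : ContinuousOn (fun t => ‖mainSum κ Ns t * Mt a N t‖ ^ 2) (Set.Icc T (2 * T)) := ((cS.mul cM).norm).pow 2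
  have cMn : ContinuousOn (fun t => ‖Mt a N t‖ ^ 2) (Set.Icc T (2 * T)) := (cM.norm).pow 2
  have iSM := integrable_wre_mul_of_continuousOn hH hHT cSMn
  have iM := integrable_wre_mul_of_continuousOn hH hHT cMn
  have : (fun t => dyadicWindowRe T H t * (supE * (ε₂ * ‖mainSum κ Ns t * Mt a N t‖ ^ 2 + ε₂⁻¹ * ‖Mt a N t‖ ^ 2) / 2))
      = fun t => (supE * ε₂ / 2) * (dyadicWindowRe T H t * ‖mainSum κ Ns t * Mt a N t‖ ^ 2)
        + (supE * ε₂⁻¹ / 2) * (dyadicWindowRe T H t * ‖Mt a N t‖ ^ 2) := by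
    funext t; ring
  have i1 : Integrable (fun t => (supE * ε₂ / 2) * (dyadicWindowRe T H t * ‖mainSum κ Ns t * Mt a N t‖ ^ 2)) :=
    iSM.const_mul _
  have i2 : Integrable (fun t => (supE * ε₂⁻¹ / 2) * (dyadicWindowRe T H t * ‖Mt a N t‖ ^ 2)) := iM.const_mul _
  rw [this, integral_add i1 i2, MeasureTheory.integral_const_mul, MeasureTheory.integral_const_mul]
  ring

/-- **`∫ w 𝒬 ≥ c₀ W`** when `𝒬(t) ≥ c₀` for `t ≥ T`. [folklore] -/
theorem integral_wre_quadForm_ge (a : ℕ → ℂ) (N : ℕ) {T H c₀ : ℝ} (hH : 0 < H) (hHT : H ≤ T)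
    (hQ : ∀ t, T ≤ t → c₀ ≤ bchQuadForm (Real.exp 1 * t / 4) N a) :
    c₀ * (∫ t, dyadicWindowRe T H t)
      ≤ ∫ t, dyadicWindowRe T H t * bchQuadForm (Real.exp 1 * t / 4) N a := by
  have hT : 0 < T := hH.trans_le hHT
  have iW : Integrable (dyadicWindowRe T H) := by
    have := integrable_wre_mul_of_continuousOn hH hHT (F := fun _ => (1 : ℝ)) continuousOn_const
    simpa using this
  have cQ : ContinuousOn (fun t => bchQuadForm (Real.exp 1 * t / 4) N a) (Set.Icc T (2 * T)) := by
    unfold bchQuadForm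
    refine continuousOn_finsetSum _ fun m hm => continuousOn_finsetSum _ fun n hn => ?_
    have hm0 : (0 : ℝ) < m := by exact_mod_cast (Finset.mem_Icc.1 hm).1
    have hn0 : (0 : ℝ) < n := by exact_mod_cast (Finset.mem_Icc.1 hn).1
    have hg0 : (0 : ℝ) < (Nat.gcd m n : ℝ) := by exact_mod_cast Nat.gcd_pos_of_pos_left n (Finset.mem_Icc.1 hm).1
    refine continuousOn_const.mul (((ContinuousOn.add ?_ continuousOn_const).add continuousOn_const).sub
      continuousOn_const)
    refine ContinuousOn.log (by fun_prop) fun t ht => ?_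
    have : 0 < t := hT.trans_le ht.1
    have := Real.exp_pos 1
    positivity
  have iQ := integrable_wre_mul_of_continuousOn hH hHT cQ
  have i0 : Integrable fun t => dyadicWindowRe T H t * c₀ := by
    have := iW.mul_const c₀; simpa using this
  have hmono := integral_wre_mono hH hHT i0 iQ (fun t ht => hQ t ht.1)
  rw [MeasureTheory.integral_mul_const] at hmono
  linarith


/-! ### From the window to the dyadic integral, the profile constant, and `sup |E|` -/

/-- **`∫ w|f|² ≤ ∫_T^{2T} |f|²`** for the real window `0 ≤ w ≤ 𝟙_{[T,2T]}`. [folklore] -/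
theorem integral_wre_normSq_f_le (a : ℕ → ℂ) (N : ℕ) {T H : ℝ} (hH : 0 < H) (hHT : H ≤ T) :
    ∫ t, dyadicWindowRe T H t * ‖1 - riemannZeta (1 / 2 + t * I) * Mt a N t‖ ^ 2
      ≤ ∫ t in T..(2 * T), ‖1 - riemannZeta (1 / 2 + t * I) * Mt a N t‖ ^ 2 := by
  have hT : 0 < T := hH.trans_le hHT
  have hT2 : T ≤ 2 * T := by linarith
  have cf : Continuous fun t : ℝ => ‖1 - riemannZeta (1 / 2 + t * I) * Mt a N t‖ ^ 2 :=
    ((continuous_const.sub (continuous_zeta_half_line.mul (continuous_Mt a N))).norm).pow 2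
  rw [integral_wre_mul_eq_setIntegral hH hHT, intervalIntegral.integral_of_le hT2, ← integral_Icc_eq_integral_Ioc]
  refine setIntegral_mono_on ?_ cf.continuousOn.integrableOn_Icc measurableSet_Icc fun t _ => ?_
  · exact (((continuous_dyadicWindowRe T H).mul cf).continuousOn).integrableOn_Icc
  · have hw := dyadicWindowRe_mem_Icc hH hHT t
    have h0 : 0 ≤ ‖1 - riemannZeta (1 / 2 + t * I) * Mt a N t‖ ^ 2 := sq_nonneg _
    nlinarith [hw.1, hw.2]

/-- **One derivative constant for all orders `≤ k`** of the profiles `t ↦ R_κ(t/(2πn²))`. [folklore] -/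
theorem exists_profile_const {κ : ℝ} (hκ : 0 < κ) (k : ℕ) :
    ∃ B : ℝ, 0 ≤ B ∧ ∀ T : ℝ, 0 < T → ∀ n : ℕ, 1 ≤ n → ∀ j ≤ k, ∀ t : ℝ, T ≤ t →
      ‖iteratedDeriv j (prof κ n) t‖ ≤ B / T ^ j := by
  induction k with
  | zero =>
    obtain ⟨B, hB0, hB⟩ := norm_iteratedDeriv_weightProfile_le hκ 0
    refine ⟨B, hB0, fun T hT n hn j hj t ht => ?_⟩
    have hj0 : j = 0 := Nat.le_zero.1 hj
    subst hj0
    exact hB n hn T hT t ht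
  | succ k ih =>
    obtain ⟨B, hB0, hB⟩ := ih
    obtain ⟨B', hB'0, hB'⟩ := norm_iteratedDeriv_weightProfile_le hκ (k + 1)
    refine ⟨max B B', le_max_of_le_left hB0, fun T hT n hn j hj t ht => ?_⟩
    rcases Nat.lt_or_ge j (k + 1) with hlt | hge
    · exact (hB T hT n hn j (Nat.lt_succ_iff.1 hlt) t ht).trans
        (div_le_div_of_nonneg_right (le_max_left _ _) (pow_nonneg hT.le _))
    · have hj' : j = k + 1 := le_antisymm hj hge
      subst hj'
      exact (hB' n hn T hT t ht).trans (div_le_div_of_nonneg_right (le_max_right _ _) (pow_nonneg hT.le _))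

/-- **`sup_{[T,2T]} |E| ≤ C_A T^{-1/4} log(2T)`** for `T ≥ max(t_A, 1)` and `N_s ≥ (6/5)√(2T/2π)`. [folklore] -/
theorem supE_bound {κ : ℝ} {C tA : ℝ}
    (hAFE : ∀ t : ℝ, tA ≤ t → ∀ N : ℕ, 6 / 5 * Real.sqrt (t / (2 * π)) ≤ N →
      ‖riemannZeta (1 / 2 + t * I) - sdAFE κ N t‖ ≤ C * t ^ (-(1 / 4 : ℝ)) * Real.log t)
    {T : ℝ} (hT : 1 ≤ T) (hTA : tA ≤ T) {Ns : ℕ} (hNs : 6 / 5 * Real.sqrt (2 * T / (2 * π)) ≤ Ns) :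
    ∀ t ∈ Set.Icc T (2 * T), ‖riemannZeta (1 / 2 + t * I) - sdAFE κ Ns t‖
      ≤ |C| * T ^ (-(1 / 4 : ℝ)) * Real.log (2 * T) := by
  intro t ht
  have hπ := Real.pi_pos
  have ht0 : 0 < t := by linarith [ht.1]
  have hNs' : 6 / 5 * Real.sqrt (t / (2 * π)) ≤ Ns := by
    refine le_trans ?_ hNs
    gcongr
    exact ht.2
  have h := hAFE t (hTA.trans ht.1) Ns hNs'
  refine h.trans ?_
  have hlog : 0 ≤ Real.log t := Real.log_nonneg (hT.trans ht.1)
  have hlog2 : Real.log t ≤ Real.log (2 * T) := Real.log_le_log ht0 ht.2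
  have hpow : t ^ (-(1 / 4 : ℝ)) ≤ T ^ (-(1 / 4 : ℝ)) :=
    Real.rpow_le_rpow_of_nonpos (by linarith) ht.1 (by norm_num)
  have hpow0 : 0 ≤ t ^ (-(1 / 4 : ℝ)) := by positivity
  have hTpow0 : 0 ≤ T ^ (-(1 / 4 : ℝ)) := by positivity
  calc C * t ^ (-(1 / 4 : ℝ)) * Real.log t ≤ |C| * t ^ (-(1 / 4 : ℝ)) * Real.log t := by
        gcongr; exact le_abs_self C
    _ ≤ |C| * T ^ (-(1 / 4 : ℝ)) * Real.log (2 * T) := by gcongr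


/-! ### Bound algebra: `x ≤ K T^e` -/

/-- Product of two monomial bounds. [folklore] -/
theorem bmul {T x y Kx Ky ex ey : ℝ} (hT : 0 < T) (hx : x ≤ Kx * T ^ ex) (hy : y ≤ Ky * T ^ ey)
    (hy0 : 0 ≤ y) (hKx : 0 ≤ Kx) : x * y ≤ Kx * Ky * T ^ (ex + ey) := by
  have h1 : 0 ≤ Kx * T ^ ex := mul_nonneg hKx (Real.rpow_nonneg hT.le _)
  calc x * y ≤ (Kx * T ^ ex) * (Ky * T ^ ey) := mul_le_mul hx hy hy0 h1
    _ = Kx * Ky * T ^ (ex + ey) := by rw [Real.rpow_add hT]; ring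

/-- Raising the exponent (`T ≥ 1`). [folklore] -/
theorem bmono {T x K ex e : ℝ} (hT : 1 ≤ T) (hx : x ≤ K * T ^ ex) (hK : 0 ≤ K) (h : ex ≤ e) :
    x ≤ K * T ^ e :=
  hx.trans (mul_le_mul_of_nonneg_left (Real.rpow_le_rpow_of_exponent_le hT h) hK)

/-- Sum of two monomial bounds (`T ≥ 1`). [folklore] -/
theorem badd {T x y Kx Ky ex ey e : ℝ} (hT : 1 ≤ T) (hx : x ≤ Kx * T ^ ex) (hy : y ≤ Ky * T ^ ey)
    (hKx : 0 ≤ Kx) (hKy : 0 ≤ Ky) (hex : ex ≤ e) (hey : ey ≤ e) : x + y ≤ (Kx + Ky) * T ^ e := by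
  have := bmono hT hx hKx hex
  have := bmono hT hy hKy hey
  linarith

/-- The final step for an error piece: `P ≤ K T^{1−δ}` and `T^δ ≥ 16K/ε` give `P ≤ εT/16`. [folklore] -/
theorem final_piece {P K T δ ε : ℝ} (hP : P ≤ K * T ^ (1 - δ)) (hT : 0 < T) (hε : 0 < ε)
    (hlarge : 16 * K / ε ≤ T ^ δ) : P ≤ ε * T / 16 := by
  have hTδ : 0 < T ^ δ := Real.rpow_pos_of_pos hT δ
  have h1 : T ^ (1 - δ) = T / T ^ δ := by rw [Real.rpow_sub hT, Real.rpow_one]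
  rw [h1] at hP
  have h2 : 16 * K ≤ ε * T ^ δ := by
    have := (div_le_iff₀ hε).1 hlarge; linarith
  have h3 : K * (T / T ^ δ) ≤ ε * T / 16 := by
    rw [mul_div_assoc', div_le_iff₀ hTδ]
    nlinarith [hT]
  exact hP.trans h3

/-- `1 + log(2T) ≤ (3/δ) T^δ` for `T ≥ 1`, `0 < δ ≤ 1`. [folklore] -/
theorem one_add_log_le {T δ : ℝ} (hT : 1 ≤ T) (hδ : 0 < δ) (hδ1 : δ ≤ 1) :
    1 + Real.log (2 * T) ≤ 3 / δ * T ^ δ := by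
  have hT0 : 0 < T := by linarith
  have h1 : Real.log (2 * T) ≤ (2 * T) ^ δ / δ := Real.log_le_rpow_div (by linarith) hδ
  have h2 : (2 * T) ^ δ ≤ 2 * T ^ δ := by
    rw [Real.mul_rpow (by norm_num) hT0.le]
    have : (2 : ℝ) ^ δ ≤ 2 := by
      calc (2 : ℝ) ^ δ ≤ 2 ^ (1 : ℝ) := Real.rpow_le_rpow_of_exponent_le (by norm_num) hδ1
        _ = 2 := Real.rpow_one 2
    exact mul_le_mul_of_nonneg_right this (Real.rpow_nonneg hT0.le _)
  have h3 : 1 ≤ T ^ δ := Real.one_le_rpow hT hδ.le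
  have h4 : 1 ≤ T ^ δ / δ := by
    rw [le_div_iff₀ hδ]; nlinarith
  calc 1 + Real.log (2 * T) ≤ T ^ δ / δ + 2 * T ^ δ / δ := by
        have := div_le_div_of_nonneg_right h2 hδ.le
        linarith
    _ = 3 / δ * T ^ δ := by ring

/-- `∫ w · F = ∫ w_re F` as a real number cast to `ℂ`. [folklore] -/
theorem integral_w_ofReal (T H : ℝ) (F : ℝ → ℝ) :
    ∫ t, dyadicWindow T H t * ((F t : ℝ) : ℂ) = ((∫ t, dyadicWindowRe T H t * F t : ℝ) : ℂ) := by
  rw [← integral_complex_ofReal]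
  refine integral_congr_ae (Filter.Eventually.of_forall fun t => ?_)
  show dyadicWindow T H t * ((F t : ℝ) : ℂ) = ((dyadicWindowRe T H t * F t : ℝ) : ℂ)
  rw [dyadicWindow_eq_ofReal, Complex.ofReal_mul]

/-! ### The bookkeeping of the lower bound -/

/-- **Numerics of the lower bound.** The real inequalities of the argument (see the module
docstring) imply `T(1/θ − ε) ≤ X_f = ∫ w |1 − ζM|²`, provided each of the eight error pieces is
`≤ εT/16`. [folklore] -/
theorem numerics {θ ε η T W XM XSM Xg Xf ReI1 ReEM ReI2 ReES D2 Qint supE ε₂ ε₃ E2 E5 E6 : ℝ}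
    (hθ : 0 < θ) (hε : 0 < ε) (hε1 : ε ≤ 1 / θ) (hη0 : 0 ≤ η) (hη : 2 * η ≤ ε * θ / 8) (hT : 0 < T)
    (hW1 : T * (1 - 2 * η) ≤ W) (hε₃ : 0 < ε₃)
    (hg : Xg = W - 2 * (ReI1 - ReEM) + 2 * (ReI2 - ReES))
    (hf : Xg - ε₃ * Xg - ε₃⁻¹ * (supE ^ 2 * XM) ≤ Xf)
    (hXg : Xg ≤ 2 * W + 8 * XSM)
    (hI1 : |ReI1 - W| ≤ E2) (hEM : |ReEM| ≤ supE * (W + XM) / 2)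
    (hES : |ReES| ≤ supE * (ε₂ * XSM + ε₂⁻¹ * XM) / 2)
    (hI2 : |2 * ReI2 - 2 * D2| ≤ 2 * E5) (hD : |2 * D2 - Qint| ≤ E6)
    (hQ : (1 + 1 / θ - ε / 4) * W ≤ Qint)
    (hP1 : 2 * E2 ≤ ε * T / 16) (hP2 : 2 * E5 ≤ ε * T / 16) (hP3 : E6 ≤ ε * T / 16)
    (hP4 : supE * W ≤ ε * T / 16) (hP5 : supE * XM * (1 + ε₂⁻¹) ≤ ε * T / 16)
    (hP6 : supE * ε₂ * XSM ≤ ε * T / 16) (hP7 : ε₃ * (2 * W + 8 * XSM) ≤ ε * T / 16)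
    (hP8 : ε₃⁻¹ * (supE ^ 2 * XM) ≤ ε * T / 16) :
    T * (1 / θ - ε) ≤ Xf := by
  -- unpack the absolute values
  have h1 := (abs_le.1 hI1).2      -- `ReI1 ≤ W + E2`
  have h2 := (abs_le.1 hEM).1      -- `ReEM ≥ -supE(W+XM)/2`
  have h3 := (abs_le.1 hES).2      -- `ReES ≤ supE(...)/2`
  have h4 := (abs_le.1 hI2).1      -- `2 ReI2 ≥ 2 D2 - 2 E5`
  have h5 := (abs_le.1 hD).1       -- `2 D2 ≥ Qint - E6`
  -- `Xg ≥ W(1/θ − ε/4) − ERR1`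
  have hXg_low : W * (1 / θ - ε / 4) - (2 * E2 + 2 * E5 + E6 + supE * (W + XM)
      + supE * (ε₂ * XSM + ε₂⁻¹ * XM)) ≤ Xg := by
    rw [hg]; linarith
  -- `Xf ≥ Xg − ε₃(2W + 8XSM) − ε₃⁻¹ supE² XM`
  have hXf_low : Xg - ε₃ * (2 * W + 8 * XSM) - ε₃⁻¹ * (supE ^ 2 * XM) ≤ Xf := by
    have : ε₃ * Xg ≤ ε₃ * (2 * W + 8 * XSM) := mul_le_mul_of_nonneg_left hXg hε₃.le
    linarith
  -- `W(1/θ − ε/4) ≥ T(1 − 2η)(1/θ − ε/4) ≥ T(1/θ − 3ε/8)`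
  have hpos : 0 ≤ 1 / θ - ε / 4 := by linarith
  have hWlow : T * (1 / θ - ε / 4) - T * (ε / 8) ≤ W * (1 / θ - ε / 4) := by
    have e1 : T * (1 - 2 * η) * (1 / θ - ε / 4) ≤ W * (1 / θ - ε / 4) :=
      mul_le_mul_of_nonneg_right hW1 hpos
    -- `T · 2η · (1/θ − ε/4) ≤ T · 2η/θ ≤ T ε/8`
    have e2 : T * (2 * η) * (1 / θ - ε / 4) ≤ T * (ε / 8) := by
      have hθ' : 2 * η * (1 / θ) ≤ ε / 8 := by
        rw [mul_one_div, div_le_iff₀ hθ]; linarith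
      have hprod : 0 ≤ 2 * η * (ε / 4) := by positivity
      have h6 : 2 * η * (1 / θ - ε / 4) ≤ ε / 8 := by
        calc 2 * η * (1 / θ - ε / 4) = 2 * η * (1 / θ) - 2 * η * (ε / 4) := by ring
          _ ≤ 2 * η * (1 / θ) := by linarith
          _ ≤ ε / 8 := hθ'
      have h7 := mul_le_mul_of_nonneg_left h6 hT.le
      calc T * (2 * η) * (1 / θ - ε / 4) = T * (2 * η * (1 / θ - ε / 4)) := by ring
        _ ≤ T * (ε / 8) := h7
    have e3 : T * (1 - 2 * η) * (1 / θ - ε / 4) = T * (1 / θ - ε / 4) - T * (2 * η) * (1 / θ - ε / 4) := by ring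
    linarith [e1, e2, e3]
  -- the supE pieces: `supE (W + XM) + supE(ε₂ XSM + ε₂⁻¹ XM) ≤ P4 + P5 + P6`
  have hsup : supE * (W + XM) + supE * (ε₂ * XSM + ε₂⁻¹ * XM)
      ≤ ε * T / 16 + ε * T / 16 + ε * T / 16 := by
    have e : supE * (W + XM) + supE * (ε₂ * XSM + ε₂⁻¹ * XM)
        = supE * W + supE * XM * (1 + ε₂⁻¹) + supE * ε₂ * XSM := by ring
    rw [e]; linarith
  have e5 : T * (1 / θ - ε) = (T * (1 / θ - ε / 4) - T * (ε / 8)) - 10 * (ε * T / 16) := by ring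
  have hεT : 0 ≤ ε * T / 16 := by positivity
  rw [e5]
  linarith [hXg_low, hXf_low, hWlow, hsup, hP1, hP2, hP3, hP7, hP8]

/-! ### The estimate at a fixed large `T` -/

set_option maxHeartbeats 10000000 in
/-- **The lower bound at a fixed large `T`.** All parameters fixed as in the module docstring and all
largeness conditions on `T` listed as hypotheses; conclusion `T(1/θ − ε) ≤ ∫_T^{2T} |1 − ζM_θ|²`.
[cite: Radziwill2012, Prop. B] -/
theorem core_at_T {θ ε δ η B CA Ca T Kt : ℝ} {k : ℕ} {a : ℕ → ℂ}
    (hθ : 0 < θ) (hθ2 : θ < 1 / 2) (hε : 0 < ε) (hε1 : ε ≤ 1 / θ) (hδ : δ = (1 / 2 - θ) / 16)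
    (hη0 : 0 < η) (hη8 : η ≤ 1 / 8) (hηε : 2 * η ≤ ε * θ / 8) (hk : 16 / (1 / 2 - θ) ≤ k)
    (hB0 : 0 ≤ B)
    (hBρ : ∀ T' : ℝ, 0 < T' → ∀ n : ℕ, 1 ≤ n → ∀ j ≤ k, ∀ t : ℝ, T' ≤ t →
      ‖iteratedDeriv j (prof (1 / 6) n) t‖ ≤ B / T' ^ j)
    (hCa : 1 ≤ Ca) (ha : ∀ n : ℕ, 1 ≤ n → ‖a n‖ ≤ Ca * (n : ℝ) ^ δ) (ha1 : a 1 = 1)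
    (hT16 : 16 ≤ T) (hTη : 1 / η ≤ T)
    (hE : ∀ t ∈ Set.Icc T (2 * T), ‖riemannZeta (1 / 2 + t * I)
        - sdAFE (1 / 6) (⌊6 / 5 * Real.sqrt (T / π)⌋₊ + 1) t‖ ≤ |CA| * T ^ (-(1 / 4 : ℝ)) * Real.log (2 * T))
    (hQ : ∀ t : ℝ, T ≤ t → 1 + 1 / θ - ε / 4 ≤ bchQuadForm (Real.exp 1 * t / 4) ⌊T ^ θ⌋₊ a)
    (hibp : 6 / η ≤ T ^ ((1 / 2 - θ) / 2)) (hsm : 8 ≤ T ^ (1 / 2 - θ))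
    (hKt : Kt = (2 * (4 * Ca * oscDecayConst k + 24 * Ca)
      + 2 * (32 * Ca ^ 2 * oscDecayConst k * B
          + 6 * ((Ca ^ 2 * (3 / δ) ^ 2 + 32 * Ca ^ 2 * (oscDecayConst k * (2 ^ k * B * B)))
            + (Ca ^ 2 * (3 / δ) + 4 * Ca ^ 2 * oscDecayConst k)))
      + 30 * Ca ^ 2 * (3 / δ)
      + |CA| * (3 / δ)
      + 2 * |CA| * (3 / δ) * (Ca ^ 2 * (3 / δ) + 4 * Ca ^ 2 * oscDecayConst k)
      + |CA| * (3 / δ) * (Ca ^ 2 * (3 / δ) ^ 2 + 32 * Ca ^ 2 * (oscDecayConst k * (2 ^ k * B * B)))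
      + (2 + 8 * (Ca ^ 2 * (3 / δ) ^ 2 + 32 * Ca ^ 2 * (oscDecayConst k * (2 ^ k * B * B))))
      + CA ^ 2 * (3 / δ) ^ 2 * (Ca ^ 2 * (3 / δ) + 4 * Ca ^ 2 * oscDecayConst k)))
    (hlarge : 16 * Kt / ε ≤ T ^ δ) :
    T * (1 / θ - ε) ≤ ∫ t in T..(2 * T), ‖1 - riemannZeta (1 / 2 + t * I) * Mt a ⌊T ^ θ⌋₊ t‖ ^ 2 := by
  -- basic positivity
  have hT1 : 1 ≤ T := by linarith
  have hT0 : 0 < T := by linarith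
  have hπ := Real.pi_pos
  have hπ3 := Real.pi_gt_three
  have hδ0 : 0 < δ := by rw [hδ]; linarith
  have hδ1 : δ ≤ 1 := by rw [hδ]; linarith
  have hhalf : 0 < 1 / 2 - θ := by linarith
  have hκ : (0 : ℝ) < 1 / 6 := by norm_num
  have hCa0 : 0 ≤ Ca := by linarith
  -- parameters
  set N : ℕ := ⌊T ^ θ⌋₊ with hN
  set Ns : ℕ := ⌊6 / 5 * Real.sqrt (T / π)⌋₊ + 1 with hNs
  set H : ℝ := η * T with hH
  set Lm : ℝ := T ^ δ with hLm
  obtain ⟨cδ, hcδ⟩ : ∃ c : ℝ, c = 3 / δ := ⟨_, rfl⟩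
  -- `N`
  have hTθ1 : 1 ≤ T ^ θ := Real.one_le_rpow hT1 hθ.le
  have hN1 : 1 ≤ N := (Nat.one_le_floor_iff _).2 hTθ1
  have hNle : (N : ℝ) ≤ T ^ θ := Nat.floor_le (by positivity)
  have hN0 : (0 : ℝ) < N := by exact_mod_cast hN1
  have hThalf : T ^ (1 / 2 : ℝ) = Real.sqrt T := by rw [Real.sqrt_eq_rpow]
  have hTθ_le : T ^ θ ≤ Real.sqrt T := by rw [← hThalf]; exact Real.rpow_le_rpow_of_exponent_le hT1 hθ2.le
  have hsqrtT4 : 4 ≤ Real.sqrt T := by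
    rw [show (4 : ℝ) = Real.sqrt 16 by rw [show (16 : ℝ) = 4 ^ 2 by norm_num, Real.sqrt_sq (by norm_num)]]
    exact Real.sqrt_le_sqrt hT16
  have hsqT : Real.sqrt T * Real.sqrt T = T := Real.mul_self_sqrt hT0.le
  have hsqrtT_le : Real.sqrt T ≤ T := by
    calc Real.sqrt T ≤ Real.sqrt T * Real.sqrt T := le_mul_of_one_le_right (Real.sqrt_nonneg _) (by linarith)
      _ = T := hsqT
  have hNT : (N : ℝ) ≤ T := hNle.trans (hTθ_le.trans hsqrtT_le)
  have hsqrtN : Real.sqrt N ≤ T ^ (θ / 2) := by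
    calc Real.sqrt N ≤ Real.sqrt (T ^ θ) := Real.sqrt_le_sqrt hNle
      _ = T ^ (θ / 2) := by
          rw [Real.sqrt_eq_rpow, ← Real.rpow_mul hT0.le]; ring_nf
  -- `Ns`
  have hNs1 : 1 ≤ Ns := Nat.le_add_left 1 _
  have hNs0 : (0 : ℝ) < Ns := by exact_mod_cast hNs1
  have hsqπ : Real.sqrt (T / π) ≤ Real.sqrt T * (2 / 3) := by
    rw [Real.sqrt_div hT0.le]
    have hπs : 3 / 2 ≤ Real.sqrt π := by
      rw [show (3 / 2 : ℝ) = Real.sqrt (9 / 4) by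
        rw [show (9 / 4 : ℝ) = (3 / 2) ^ 2 by norm_num, Real.sqrt_sq (by norm_num)]]
      exact Real.sqrt_le_sqrt (by linarith)
    rw [div_le_iff₀ (by positivity)]
    calc Real.sqrt T = Real.sqrt T * (2 / 3) * (3 / 2) := by ring
      _ ≤ Real.sqrt T * (2 / 3) * Real.sqrt π := mul_le_mul_of_nonneg_left hπs (by positivity)
  have hNsle : (Ns : ℝ) ≤ 2 * Real.sqrt T := by
    have h1 : (Ns : ℝ) ≤ 6 / 5 * Real.sqrt (T / π) + 1 := by
      rw [hNs]; push_cast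
      linarith [Nat.floor_le (show 0 ≤ 6 / 5 * Real.sqrt (T / π) by positivity)]
    have h2 : 6 / 5 * Real.sqrt (T / π) ≤ 6 / 5 * (Real.sqrt T * (2 / 3)) := by gcongr
    linarith
  have hNsge : 6 / 5 * Real.sqrt (T / π) ≤ Ns := by
    rw [hNs]; push_cast
    linarith [Nat.lt_floor_add_one (6 / 5 * Real.sqrt (T / π))]
  have h2T2π : 2 * T / (2 * π) = T / π := by field_simp
  have hNs_sd : 6 / 5 * Real.sqrt (2 * T / (2 * π)) ≤ Ns := by rwa [h2T2π]
  -- `H`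
  have hH0 : 0 < H := by positivity
  have hH1 : 1 ≤ H := by
    have : 1 / η * η ≤ T * η := mul_le_mul_of_nonneg_right hTη hη0.le
    rw [one_div, inv_mul_cancel₀ hη0.ne'] at this
    rw [hH]; linarith
  have hHT : H ≤ T := by rw [hH]; exact mul_le_of_le_one_left hT0.le (by linarith)
  have h2H : 2 * H ≤ T := by
    rw [hH]
    calc 2 * (η * T) = (2 * η) * T := by ring
      _ ≤ 1 * T := mul_le_mul_of_nonneg_right (by linarith) hT0.le
      _ = T := one_mul T
  -- `Lm`, `cδ`, logs
  have hLm1 : 1 ≤ Lm := Real.one_le_rpow hT1 hδ0.le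
  have hLm0 : 0 < Lm := by linarith
  have hcδ0 : 0 < cδ := by rw [hcδ]; positivity
  have hlog : 1 + Real.log (2 * T) ≤ cδ * Lm := by rw [hcδ]; exact one_add_log_le hT1 hδ0 hδ1
  have hlog0 : 0 ≤ Real.log (2 * T) := Real.log_nonneg (by linarith)
  have hCk1 : 1 ≤ oscDecayConst k := one_le_oscDecayConst k
  have hCk0 : 0 ≤ oscDecayConst k := by linarith
  have hCk'0 : 0 ≤ oscDecayConst k * (2 ^ k * B * B) := by positivity
  -- coefficients on `[1, N]`
  have han : ∀ n ∈ Finset.Icc 1 N, ‖a n‖ ≤ Ca * Lm := by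
    intro n hn
    obtain ⟨hn1, hnN⟩ := Finset.mem_Icc.1 hn
    refine (ha n hn1).trans (mul_le_mul_of_nonneg_left ?_ hCa0)
    calc (n : ℝ) ^ δ ≤ (T ^ θ) ^ δ := Real.rpow_le_rpow (by positivity) ((Nat.cast_le.2 hnN).trans hNle) hδ0.le
      _ = T ^ (θ * δ) := by rw [← Real.rpow_mul hT0.le]
      _ ≤ T ^ δ := Real.rpow_le_rpow_of_exponent_le hT1 (mul_le_of_le_one_left hδ0.le (by linarith))
  -- harmonic sums
  have hharmN : ∑ k ∈ Finset.Icc 1 N, (1 : ℝ) / k ≤ cδ * Lm := by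
    refine (AFE.sum_Icc_inv_le_log N).trans (le_trans ?_ hlog)
    have : (N : ℝ) + 1 ≤ 2 * T := by linarith
    linarith [Real.log_le_log (by positivity) this]
  have h8T : 8 * Real.sqrt T ≤ 2 * T := by
    calc 8 * Real.sqrt T = 2 * (4 * Real.sqrt T) := by ring
      _ ≤ 2 * (Real.sqrt T * Real.sqrt T) := by
          refine mul_le_mul_of_nonneg_left ?_ (by norm_num)
          exact mul_le_mul_of_nonneg_right hsqrtT4 (Real.sqrt_nonneg _)
      _ = 2 * T := by rw [hsqT]
  have hharmNs : ∑ n ∈ Finset.Icc 1 Ns, (1 : ℝ) / n ≤ cδ * Lm := by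
    refine (AFE.sum_Icc_inv_le_log Ns).trans (le_trans ?_ hlog)
    have : (Ns : ℝ) + 1 ≤ 2 * T := by linarith
    linarith [Real.log_le_log (by positivity) this]
  -- the coefficient sums
  set A1 : ℝ := ∑ k ∈ Finset.Icc 1 N, ‖a k‖ * (k : ℝ) ^ (-(1 / 2 : ℝ)) with hA1
  set A0 : ℝ := ∑ k ∈ Finset.Icc 1 N, ‖a k‖ with hA0
  set Am : ℝ := ∑ k ∈ Finset.Icc 1 N, ‖a k‖ / k with hAm
  set A2 : ℝ := ∑ k ∈ Finset.Icc 1 N, ‖a k‖ ^ 2 / k with hA2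
  have hA1_0 : 0 ≤ A1 := Finset.sum_nonneg fun k _ => by positivity
  have hA0_0 : 0 ≤ A0 := Finset.sum_nonneg fun k _ => by positivity
  have hAm_0 : 0 ≤ Am := Finset.sum_nonneg fun k _ => by positivity
  have hA2_0 : 0 ≤ A2 := Finset.sum_nonneg fun k _ => by positivity
  have hA1b : A1 ≤ 2 * Ca * T ^ (δ + θ / 2) := by
    calc A1 ≤ ∑ k ∈ Finset.Icc 1 N, Ca * Lm * (k : ℝ) ^ (-(1 / 2 : ℝ)) :=
          Finset.sum_le_sum fun k hk => mul_le_mul_of_nonneg_right (han k hk) (by positivity)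
      _ = Ca * Lm * ∑ k ∈ Finset.Icc 1 N, (k : ℝ) ^ (-(1 / 2 : ℝ)) := by rw [Finset.mul_sum]
      _ ≤ Ca * Lm * (2 * Real.sqrt N) := mul_le_mul_of_nonneg_left (AFE.sum_Icc_rpow_neg_half_le N) (by positivity)
      _ ≤ Ca * Lm * (2 * T ^ (θ / 2)) := by gcongr
      _ = 2 * Ca * T ^ (δ + θ / 2) := by rw [hLm, Real.rpow_add hT0]; ring
  have hA0b : A0 ≤ Ca * T ^ (δ + θ) := by
    calc A0 ≤ ∑ k ∈ Finset.Icc 1 N, Ca * Lm := Finset.sum_le_sum han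
      _ = N * (Ca * Lm) := by rw [Finset.sum_const, Nat.card_Icc, Nat.add_sub_cancel, nsmul_eq_mul]
      _ ≤ T ^ θ * (Ca * Lm) := mul_le_mul_of_nonneg_right hNle (by positivity)
      _ = Ca * T ^ (δ + θ) := by rw [hLm, Real.rpow_add hT0]; ring
  have hAmb : Am ≤ Ca * cδ * T ^ (δ + δ) := by
    calc Am ≤ ∑ k ∈ Finset.Icc 1 N, Ca * Lm * (1 / (k : ℝ)) := Finset.sum_le_sum fun k hk => by
            rw [div_eq_mul_one_div]; exact mul_le_mul_of_nonneg_right (han k hk) (by positivity)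
      _ = Ca * Lm * ∑ k ∈ Finset.Icc 1 N, 1 / (k : ℝ) := by rw [Finset.mul_sum]
      _ ≤ Ca * Lm * (cδ * Lm) := mul_le_mul_of_nonneg_left hharmN (by positivity)
      _ = Ca * cδ * T ^ (δ + δ) := by rw [hLm, Real.rpow_add hT0]; ring
  have hA2b : A2 ≤ Ca ^ 2 * cδ * T ^ (δ + δ + δ) := by
    calc A2 ≤ ∑ k ∈ Finset.Icc 1 N, (Ca * Lm) ^ 2 * (1 / (k : ℝ)) := Finset.sum_le_sum fun k hk => by
            rw [div_eq_mul_one_div]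
            exact mul_le_mul_of_nonneg_right (pow_le_pow_left₀ (norm_nonneg _) (han k hk) 2) (by positivity)
      _ = (Ca * Lm) ^ 2 * ∑ k ∈ Finset.Icc 1 N, 1 / (k : ℝ) := by rw [Finset.mul_sum]
      _ ≤ (Ca * Lm) ^ 2 * (cδ * Lm) := mul_le_mul_of_nonneg_left hharmN (by positivity)
      _ = Ca ^ 2 * cδ * T ^ (δ + δ + δ) := by rw [hLm, Real.rpow_add hT0, Real.rpow_add hT0]; ring
  -- IBP denominators
  set D0 : ℝ := T ^ ((1 / 2 - θ) / 2) with hD0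
  have hD0pos : 0 < D0 := Real.rpow_pos_of_pos hT0 _
  have hD0sq : D0 * D0 = T ^ (1 / 2 - θ) := by rw [hD0, ← Real.rpow_add hT0]; ring_nf
  have hηD0 : 6 ≤ η * D0 := by
    have := mul_le_mul_of_nonneg_left hibp hη0.le
    rwa [mul_div_cancel₀ _ hη0.ne'] at this
  have hD0_1 : 1 ≤ D0 := le_trans (by
    rw [le_div_iff₀ hη0]; linarith) hibp
  have hpowk : T ^ (8 : ℝ) ≤ D0 ^ k := by
    rw [hD0, ← Real.rpow_natCast, ← Real.rpow_mul hT0.le]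
    refine Real.rpow_le_rpow_of_exponent_le hT1 ?_
    have := hk
    rw [div_le_iff₀ hhalf] at this
    linarith
  have hden : ∀ (X Dn : ℝ), 0 ≤ X → D0 ≤ Dn → X / Dn ^ k ≤ X * T ^ (-(8 : ℝ)) := by
    intro X Dn hX hDn
    have hDnk : T ^ (8 : ℝ) ≤ Dn ^ k := hpowk.trans (pow_le_pow_left₀ hD0pos.le hDn k)
    rw [Real.rpow_neg hT0.le, div_eq_mul_inv]
    exact mul_le_mul_of_nonneg_left (inv_anti₀ (by positivity) hDnk) hX
  -- `T^{1/2-θ} ≤ T/ N`-type facts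
  have hThalfθ : T ^ (1 / 2 - θ) * T ^ θ = Real.sqrt T := by
    rw [← Real.rpow_add hT0, ← hThalf]; ring_nf
  have hDM : D0 ≤ H * (1 / (N : ℝ)) := by
    -- `H/N ≥ η T/T^θ ≥ η √T · T^{1/2-θ}/T^θ...`: `H/N ≥ η T^{1/2-θ} · (√T) / ... `
    have h1 : η * T ^ (1 / 2 - θ) ≤ H * (1 / (N : ℝ)) := by
      rw [hH, mul_one_div, le_div_iff₀ hN0]
      -- `η T^{1/2-θ} N ≤ η T`: `T^{1/2-θ} N ≤ T^{1/2-θ} T^θ = √T ≤ T`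
      have : T ^ (1 / 2 - θ) * N ≤ T := by
        calc T ^ (1 / 2 - θ) * N ≤ T ^ (1 / 2 - θ) * T ^ θ :=
              mul_le_mul_of_nonneg_left hNle (Real.rpow_nonneg hT0.le _)
          _ = Real.sqrt T := hThalfθ
          _ ≤ T := hsqrtT_le
      calc η * T ^ (1 / 2 - θ) * N = η * (T ^ (1 / 2 - θ) * N) := by ring
        _ ≤ η * T := mul_le_mul_of_nonneg_left this hη0.le
    refine le_trans ?_ h1
    rw [← hD0sq]
    calc D0 ≤ 6 * D0 := by linarith
      _ ≤ η * D0 * D0 := mul_le_mul_of_nonneg_right hηD0 hD0pos.le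
      _ = η * (D0 * D0) := by ring
  have hlog2 : (1 / 2 : ℝ) ≤ Real.log 2 := by linarith [Real.log_two_gt_d9]
  have hD2 : D0 ≤ H * Real.log 2 := by
    have h1 : η * T ^ (1 / 2 - θ) ≤ H * Real.log 2 := by
      rw [hH]
      have : T ^ (1 / 2 - θ) ≤ T / 2 := by
        have h1 : T ^ (1 / 2 - θ) ≤ Real.sqrt T := by
          rw [← hThalf]; exact Real.rpow_le_rpow_of_exponent_le hT1 (by linarith)
        have h2 : 2 * Real.sqrt T ≤ Real.sqrt T * Real.sqrt T :=
          mul_le_mul_of_nonneg_right (by linarith) (Real.sqrt_nonneg _)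
        rw [hsqT] at h2
        linarith
      calc η * T ^ (1 / 2 - θ) ≤ η * (T / 2) := mul_le_mul_of_nonneg_left this hη0.le
        _ = η * T * (1 / 2) := by ring
        _ ≤ η * T * Real.log 2 := mul_le_mul_of_nonneg_left hlog2 (by positivity)
    refine le_trans ?_ h1
    rw [← hD0sq]
    calc D0 ≤ 6 * D0 := by linarith
      _ ≤ η * D0 * D0 := mul_le_mul_of_nonneg_right hηD0 hD0pos.le
      _ = η * (D0 * D0) := by ring
  have hDS : D0 ≤ H * (1 / (2 * (Ns : ℝ) * N)) := by
    have h1 : η / 4 * T ^ (1 / 2 - θ) ≤ H * (1 / (2 * (Ns : ℝ) * N)) := by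
      rw [hH, mul_one_div, le_div_iff₀ (by positivity)]
      -- `(η/4) T^{1/2-θ} (2 Ns N) ≤ η T`: `Ns N T^{1/2-θ} ≤ 2√T · √T = 2T`
      have : T ^ (1 / 2 - θ) * ((Ns : ℝ) * N) ≤ 2 * T := by
        calc T ^ (1 / 2 - θ) * ((Ns : ℝ) * N) ≤ T ^ (1 / 2 - θ) * (2 * Real.sqrt T * T ^ θ) := by
              refine mul_le_mul_of_nonneg_left ?_ (Real.rpow_nonneg hT0.le _)
              exact mul_le_mul hNsle hNle hN0.le (by positivity)
          _ = 2 * Real.sqrt T * (T ^ (1 / 2 - θ) * T ^ θ) := by ring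
          _ = 2 * T := by rw [hThalfθ, mul_assoc, hsqT]
      calc η / 4 * T ^ (1 / 2 - θ) * (2 * (Ns : ℝ) * N) = η / 2 * (T ^ (1 / 2 - θ) * ((Ns : ℝ) * N)) := by ring
        _ ≤ η / 2 * (2 * T) := mul_le_mul_of_nonneg_left this (by positivity)
        _ = η * T := by ring
    refine le_trans ?_ h1
    rw [← hD0sq]
    have : 6 * D0 ≤ η * D0 * D0 := mul_le_mul_of_nonneg_right hηD0 hD0pos.le
    calc D0 ≤ (6 * D0) / 4 := by linarith
      _ ≤ (η * D0 * D0) / 4 := by linarith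
      _ = η / 4 * (D0 * D0) := by ring
  -- `L = emLen T ≥ Ns N`, covering, smallness
  have hL : Ns * N ≤ emLen T := by
    have h1 : ((Ns * N : ℕ) : ℝ) ≤ 2 * T := by
      push_cast
      calc (Ns : ℝ) * N ≤ 2 * Real.sqrt T * Real.sqrt T :=
            mul_le_mul hNsle (hNle.trans hTθ_le) hN0.le (by positivity)
        _ = 2 * T := by rw [mul_assoc, hsqT]
    have h2 : 2 * T ≤ (emLen T : ℝ) := by
      have hb := (emLen_bounds hT0.le).2
      have h32 : T ^ (3 / 2 : ℝ) = T * Real.sqrt T := by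
        rw [show (3 / 2 : ℝ) = 1 + 1 / 2 by norm_num, Real.rpow_add hT0, Real.rpow_one, hThalf]
      rw [h32] at hb
      have : 4 * T ≤ T * Real.sqrt T := by
        calc 4 * T = T * 4 := by ring
          _ ≤ T * Real.sqrt T := mul_le_mul_of_nonneg_left hsqrtT4 hT0.le
      linarith
    exact_mod_cast h1.trans h2
  have hcov : ∀ t ∈ Set.Icc T (2 * T), Real.exp (1 / 6) * Real.sqrt (t / (2 * π)) ≤ Ns := by
    intro t ht
    calc Real.exp (1 / 6) * Real.sqrt (t / (2 * π)) ≤ 6 / 5 * Real.sqrt (2 * T / (2 * π)) := by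
          refine mul_le_mul exp_one_sixth_le (Real.sqrt_le_sqrt ?_) (Real.sqrt_nonneg _) (by norm_num)
          exact div_le_div_of_nonneg_right ht.2 (by positivity)
      _ ≤ Ns := hNs_sd
  have hsmall : ∀ t ∈ Set.Icc T (2 * T), 2 * (N : ℝ) ≤ Real.exp (-(1 / 6)) * Real.sqrt (t / (2 * π)) := by
    intro t ht
    have he : 5 / 6 ≤ Real.exp (-(1 / 6 : ℝ)) := by
      rw [Real.exp_neg, le_inv_comm₀ (by norm_num) (Real.exp_pos _)]
      linarith [exp_one_sixth_le]
    have hs : Real.sqrt T / 3 ≤ Real.sqrt (t / (2 * π)) := by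
      rw [div_le_iff₀ (by norm_num : (0 : ℝ) < 3)]
      have h9 : Real.sqrt T ≤ Real.sqrt (t / (2 * π) * 9) := by
        refine Real.sqrt_le_sqrt ?_
        rw [div_mul_eq_mul_div, le_div_iff₀ (by positivity)]
        calc T * (2 * π) ≤ T * 9 := mul_le_mul_of_nonneg_left (by linarith [Real.pi_lt_d2]) hT0.le
          _ ≤ t * 9 := mul_le_mul_of_nonneg_right ht.1 (by norm_num)
      rw [Real.sqrt_mul' _ (by norm_num), show Real.sqrt 9 = 3 by
        rw [show (9 : ℝ) = 3 ^ 2 by norm_num, Real.sqrt_sq (by norm_num)]] at h9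
      exact h9
    -- `2N ≤ 2T^θ ≤ √T/4 ≤ (5/6)(√T/3)`
    have h7 : 8 * T ^ θ ≤ Real.sqrt T := by
      rw [← hThalfθ]; exact mul_le_mul_of_nonneg_right hsm (Real.rpow_nonneg hT0.le _)
    calc 2 * (N : ℝ) ≤ 2 * T ^ θ := by linarith
      _ ≤ 5 / 6 * (Real.sqrt T / 3) := by linarith [Real.sqrt_nonneg T]
      _ ≤ Real.exp (-(1 / 6)) * Real.sqrt (t / (2 * π)) := mul_le_mul he hs (by positivity) (Real.exp_pos _).le
  -- `sup |E|`
  set supE : ℝ := |CA| * T ^ (-(1 / 4 : ℝ)) * Real.log (2 * T) with hsupE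
  have hsupE0 : 0 ≤ supE := by positivity
  have hE' : ∀ t ∈ Set.Icc T (2 * T), ‖riemannZeta (1 / 2 + t * I) - sdAFE (1 / 6) Ns t‖ ≤ supE := hE
  have hsupEb : supE ≤ |CA| * cδ * T ^ (δ + -(1 / 4 : ℝ)) := by
    have : Real.log (2 * T) ≤ cδ * Lm := by linarith
    calc supE = |CA| * T ^ (-(1 / 4 : ℝ)) * Real.log (2 * T) := rfl
      _ ≤ |CA| * T ^ (-(1 / 4 : ℝ)) * (cδ * Lm) := mul_le_mul_of_nonneg_left this (by positivity)
      _ = |CA| * cδ * T ^ (δ + -(1 / 4 : ℝ)) := by rw [hLm, Real.rpow_add hT0]; ring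
  -- `ε₂`, `ε₃`
  set ε₂ : ℝ := T ^ (-(θ / 2)) with hε₂
  set ε₃ : ℝ := T ^ (-(1 / 4 + θ / 2)) with hε₃
  have hε₂0 : 0 < ε₂ := Real.rpow_pos_of_pos hT0 _
  have hε₃0 : 0 < ε₃ := Real.rpow_pos_of_pos hT0 _
  have hε₂inv : ε₂⁻¹ = T ^ (θ / 2) := by rw [hε₂, Real.rpow_neg hT0.le, inv_inv]
  have hε₃inv : ε₃⁻¹ = T ^ (1 / 4 + θ / 2) := by rw [hε₃, Real.rpow_neg hT0.le, inv_inv]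
  -- continuity / integrability
  obtain ⟨cζ, cM, cS, cV⟩ := continuousOn_players a N Ns hκ hT0
  have cMn : ContinuousOn (fun t => ‖Mt a N t‖ ^ 2) (Set.Icc T (2 * T)) := (cM.norm).pow 2
  have cSMn : ContinuousOn (fun t => ‖mainSum (1 / 6) Ns t * Mt a N t‖ ^ 2) (Set.Icc T (2 * T)) :=
    ((cS.mul cM).norm).pow 2
  have hintM : Integrable fun t => dyadicWindowRe T H t * ‖Mt a N t‖ ^ 2 :=
    integrable_wre_mul_of_continuousOn hH0 hHT cMn
  have hintSM : Integrable fun t => dyadicWindowRe T H t * ‖mainSum (1 / 6) Ns t * Mt a N t‖ ^ 2 :=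
    integrable_wre_mul_of_continuousOn hH0 hHT cSMn
  -- the analytic inputs
  have hBρT := hBρ T hT0
  have hM2 := norm_integral_window_normSq_Mt_sub_le a hN1 hH1 hHT k
  have hI1c := norm_integral_window_zeta_Mt_sub_le a hN1 hH1 hHT k han
  have hSMc := norm_integral_window_normSq_SMt_le a hN1 hNs1 hκ hH1 hHT k hB0 hBρT
  have hI2c := norm_integral_window_zeta_conjS_MM_sub_le a hN1 hNs1 hκ hH1 hHT k hB0 hBρT hε₂0 hintSM hintM
  have hDc := two_re_I2diag_sub_le a hκ hH0 hHT hL hcov hsmall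
  have hgc := integral_normSq_g_eq a N Ns hκ hH0 hHT
  have hfc := integral_normSq_f_ge a N Ns hκ hH0 hHT hε₃0 hE'
  have hXgc := integral_normSq_g_le a N Ns hκ hH0 hHT
  have hEMc := abs_re_integral_EM_le a N Ns hκ hH0 hHT hE'
  have hESc := abs_re_integral_ESMM_le a N Ns hκ hH0 hHT hε₂0 hE'
  have hQc := integral_wre_quadForm_ge a N hH0 hHT hQ
  have hW1c := le_integral_dyadicWindowRe hH0 h2H
  have hXfc := integral_wre_normSq_f_le a N hH0 hHT
  -- name the real quantities
  set W : ℝ := ∫ t, dyadicWindowRe T H t with hW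
  set XM : ℝ := ∫ t, dyadicWindowRe T H t * ‖Mt a N t‖ ^ 2 with hXM
  set XSM : ℝ := ∫ t, dyadicWindowRe T H t * ‖mainSum (1 / 6) Ns t * Mt a N t‖ ^ 2 with hXSM
  set Xg : ℝ := ∫ t, dyadicWindowRe T H t * ‖1 - sdAFE (1 / 6) Ns t * Mt a N t‖ ^ 2 with hXg
  set Xf : ℝ := ∫ t, dyadicWindowRe T H t * ‖1 - riemannZeta (1 / 2 + t * I) * Mt a N t‖ ^ 2 with hXf
  set zI1 : ℂ := ∫ t, dyadicWindow T H t * (riemannZeta (1 / 2 + t * I) * Mt a N t) with hzI1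
  set zEM : ℂ := ∫ t, dyadicWindow T H t * ((riemannZeta (1 / 2 + t * I) - sdAFE (1 / 6) Ns t) * Mt a N t) with hzEM
  set zI2 : ℂ := ∫ t, dyadicWindow T H t * (riemannZeta (1 / 2 + t * I) * conj (mainSum (1 / 6) Ns t)
      * Mt a N t * conj (Mt a N t)) with hzI2
  set zES : ℂ := ∫ t, dyadicWindow T H t * ((riemannZeta (1 / 2 + t * I) - sdAFE (1 / 6) Ns t)
      * conj (mainSum (1 / 6) Ns t) * Mt a N t * conj (Mt a N t)) with hzES
  set D : ℂ := I2diag a (1 / 6) (emLen T) Ns N T H with hDdef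
  set Qint : ℝ := ∫ t, dyadicWindowRe T H t * bchQuadForm (Real.exp 1 * t / 4) N a with hQint
  -- basic facts on `W`, `XM`, `XSM`
  have hwC : (∫ t, dyadicWindow T H t) = ((W : ℝ) : ℂ) := integral_dyadicWindow_eq T H
  have hW1 : T * (1 - 2 * η) ≤ W := by rw [hH] at hW1c; linarith
  have hWT : W ≤ T := by
    have h := integral_norm_dyadicWindow_le hH0 hHT
    have : (∫ t, ‖dyadicWindow T H t‖) = W := by
      refine integral_congr_ae (Filter.Eventually.of_forall fun t => ?_)
      show ‖dyadicWindow T H t‖ = dyadicWindowRe T H t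
      rw [dyadicWindow_eq_ofReal, Complex.norm_real, Real.norm_eq_abs,
        abs_of_nonneg (dyadicWindowRe_mem_Icc hH0 hHT t).1]
    linarith [this]
  have hW0 : 0 ≤ W := le_trans (mul_nonneg hT0.le (by linarith)) hW1
  have hXM0 : 0 ≤ XM := integral_nonneg fun t => mul_nonneg (dyadicWindowRe_mem_Icc hH0 hHT t).1 (sq_nonneg _)
  have hXSM0 : 0 ≤ XSM := integral_nonneg fun t => mul_nonneg (dyadicWindowRe_mem_Icc hH0 hHT t).1 (sq_nonneg _)
  -- `XM ≤ A2 W + A1² oscDecayConst k T T^{-8}`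
  have hXMb : XM ≤ A2 * W + A1 ^ 2 * (oscDecayConst k * T) * T ^ (-(8 : ℝ)) := by
    have e1 : (∫ t, dyadicWindow T H t * ((‖Mt a N t‖ ^ 2 : ℝ) : ℂ)) = ((XM : ℝ) : ℂ) := integral_w_ofReal T H _
    have e2 : (∑ k ∈ Finset.Icc 1 N, (((‖a k‖ ^ 2 / k : ℝ)) : ℂ)) = ((A2 : ℝ) : ℂ) := by
      rw [hA2, Complex.ofReal_sum]
    rw [e1, e2, hwC] at hM2
    have h3 : A1 ^ 2 * (oscDecayConst k * T / (H * (1 / N)) ^ k) ≤ A1 ^ 2 * (oscDecayConst k * T) * T ^ (-(8 : ℝ)) := by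
      have := hden (oscDecayConst k * T) (H * (1 / N)) (by positivity) hDM
      calc A1 ^ 2 * (oscDecayConst k * T / (H * (1 / N)) ^ k) ≤ A1 ^ 2 * (oscDecayConst k * T * T ^ (-(8 : ℝ))) :=
            mul_le_mul_of_nonneg_left this (sq_nonneg _)
        _ = _ := by ring
    have h4 : ‖((XM : ℝ) : ℂ) - ((A2 : ℝ) : ℂ) * ((W : ℝ) : ℂ)‖ = |XM - A2 * W| := by
      rw [← Complex.ofReal_mul, ← Complex.ofReal_sub, Complex.norm_real, Real.norm_eq_abs]
    rw [h4] at hM2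
    linarith [(abs_le.1 (hM2.trans h3)).2]
  -- `XSM ≤ T (cδLm)(Am)(A0) + 4 Ns A1² (oscDecayConst k * (2 ^ k * B * B)) T T^{-8}`
  have hXSMb : XSM ≤ T * (cδ * Lm * Am * A0) + 4 * Ns * A1 ^ 2 * ((oscDecayConst k * (2 ^ k * B * B)) * T) * T ^ (-(8 : ℝ)) := by
    have e1 : (∫ t, dyadicWindow T H t * ((‖mainSum (1 / 6) Ns t * Mt a N t‖ ^ 2 : ℝ) : ℂ)) = ((XSM : ℝ) : ℂ) :=
      integral_w_ofReal T H _
    rw [e1, Complex.norm_real, Real.norm_eq_abs] at hSMc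
    have h2 : T * ((∑ n ∈ Finset.Icc 1 Ns, (1 : ℝ) / n) * Am * A0) ≤ T * (cδ * Lm * Am * A0) := by
      refine mul_le_mul_of_nonneg_left ?_ hT0.le
      exact mul_le_mul_of_nonneg_right (mul_le_mul_of_nonneg_right hharmNs hAm_0) hA0_0
    have h3 : 4 * Ns * A1 ^ 2 * (oscDecayConst k * (2 ^ k * B * B) * T / (H * (1 / (2 * (Ns : ℝ) * N))) ^ k)
        ≤ 4 * Ns * A1 ^ 2 * ((oscDecayConst k * (2 ^ k * B * B)) * T) * T ^ (-(8 : ℝ)) := by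
      have := hden (oscDecayConst k * (2 ^ k * B * B) * T) (H * (1 / (2 * (Ns : ℝ) * N))) (by positivity) hDS
      calc 4 * Ns * A1 ^ 2 * (oscDecayConst k * (2 ^ k * B * B) * T / (H * (1 / (2 * (Ns : ℝ) * N))) ^ k)
          ≤ 4 * Ns * A1 ^ 2 * (oscDecayConst k * (2 ^ k * B * B) * T * T ^ (-(8 : ℝ))) :=
            mul_le_mul_of_nonneg_left this (by positivity)
        _ = _ := by ring
    linarith [le_abs_self XSM]
  -- monomial bounds for `XM`, `XSM`
  obtain ⟨KM, hKM⟩ : ∃ c : ℝ, c = Ca ^ 2 * cδ + 4 * Ca ^ 2 * oscDecayConst k := ⟨_, rfl⟩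
  obtain ⟨KS, hKS⟩ : ∃ c : ℝ, c = Ca ^ 2 * cδ ^ 2 + 32 * Ca ^ 2 * (oscDecayConst k * (2 ^ k * B * B)) := ⟨_, rfl⟩
  have hKM0 : 0 ≤ KM := by rw [hKM]; positivity
  have hKS0 : 0 ≤ KS := by rw [hKS]; positivity
  have hWb : W ≤ 1 * T ^ (1 : ℝ) := by rw [Real.rpow_one]; linarith
  have hT8 : T ^ (-(8 : ℝ)) ≤ 1 * T ^ (-(8 : ℝ)) := by rw [one_mul]
  have hXMmono : XM ≤ KM * T ^ (1 + 3 * δ) := by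
    have h1 : A2 * W ≤ Ca ^ 2 * cδ * 1 * T ^ (δ + δ + δ + 1) := bmul hT0 hA2b hWb hW0 (by positivity)
    have h2 : A1 ^ 2 ≤ 2 * Ca * (2 * Ca) * T ^ (δ + θ / 2 + (δ + θ / 2)) := by
      rw [sq]; exact bmul hT0 hA1b hA1b hA1_0 (by positivity)
    have h3 : A1 ^ 2 * (oscDecayConst k * T) ≤ 2 * Ca * (2 * Ca) * oscDecayConst k * T ^ (δ + θ / 2 + (δ + θ / 2) + 1) := by
      have : oscDecayConst k * T ≤ oscDecayConst k * T ^ (1 : ℝ) := by rw [Real.rpow_one]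
      have := bmul hT0 h2 this (by positivity) (by positivity)
      linarith
    have h4 : A1 ^ 2 * (oscDecayConst k * T) * T ^ (-(8 : ℝ)) ≤ 2 * Ca * (2 * Ca) * oscDecayConst k * 1
        * T ^ (δ + θ / 2 + (δ + θ / 2) + 1 + -(8 : ℝ)) := bmul hT0 h3 hT8 (by positivity) (by positivity)
    have h5 := badd hT1 h1 h4 (by positivity) (by positivity)
      (show δ + δ + δ + 1 ≤ 1 + 3 * δ by linarith) (show δ + θ / 2 + (δ + θ / 2) + 1 + -(8 : ℝ) ≤ 1 + 3 * δ by linarith)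
    refine hXMb.trans (h5.trans (le_of_eq ?_))
    rw [hKM]; ring
  have hXSMmono : XSM ≤ KS * T ^ (1 + θ + 4 * δ) := by
    have h1 : cδ * Lm ≤ cδ * T ^ δ := le_rfl
    have h2 : cδ * Lm * Am ≤ cδ * (Ca * cδ) * T ^ (δ + (δ + δ)) := bmul hT0 h1 hAmb hAm_0 hcδ0.le
    have h3 : cδ * Lm * Am * A0 ≤ cδ * (Ca * cδ) * Ca * T ^ (δ + (δ + δ) + (δ + θ)) :=
      bmul hT0 h2 hA0b hA0_0 (by positivity)
    have h4 : T * (cδ * Lm * Am * A0) ≤ 1 * (cδ * (Ca * cδ) * Ca) * T ^ (1 + (δ + (δ + δ) + (δ + θ))) := by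
      have hT' : T ≤ 1 * T ^ (1 : ℝ) := by rw [one_mul, Real.rpow_one]
      exact bmul hT0 hT' h3 (by positivity) zero_le_one
    have h5 : (Ns : ℝ) ≤ 2 * T ^ (1 / 2 : ℝ) := by rw [hThalf]; exact hNsle
    have h6 : A1 ^ 2 ≤ 2 * Ca * (2 * Ca) * T ^ (δ + θ / 2 + (δ + θ / 2)) := by
      rw [sq]; exact bmul hT0 hA1b hA1b hA1_0 (by positivity)
    have h7 : 4 * (Ns : ℝ) ≤ 4 * 2 * T ^ (1 / 2 : ℝ) := by linarith
    have h8 : 4 * Ns * A1 ^ 2 ≤ 4 * 2 * (2 * Ca * (2 * Ca)) * T ^ (1 / 2 + (δ + θ / 2 + (δ + θ / 2))) :=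
      bmul hT0 h7 h6 (sq_nonneg _) (by norm_num)
    have h9 : (oscDecayConst k * (2 ^ k * B * B)) * T ≤ (oscDecayConst k * (2 ^ k * B * B)) * T ^ (1 : ℝ) := by rw [Real.rpow_one]
    have h10 : 4 * Ns * A1 ^ 2 * ((oscDecayConst k * (2 ^ k * B * B)) * T) ≤ 4 * 2 * (2 * Ca * (2 * Ca)) * (oscDecayConst k * (2 ^ k * B * B))
        * T ^ (1 / 2 + (δ + θ / 2 + (δ + θ / 2)) + 1) := bmul hT0 h8 h9 (by positivity) (by positivity)
    have h11 : 4 * Ns * A1 ^ 2 * ((oscDecayConst k * (2 ^ k * B * B)) * T) * T ^ (-(8 : ℝ)) ≤ 4 * 2 * (2 * Ca * (2 * Ca)) * (oscDecayConst k * (2 ^ k * B * B)) * 1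
        * T ^ (1 / 2 + (δ + θ / 2 + (δ + θ / 2)) + 1 + -(8 : ℝ)) := bmul hT0 h10 hT8 (by positivity) (by positivity)
    have h12 := badd hT1 h4 h11 (by positivity) (by positivity)
      (show 1 + (δ + (δ + δ) + (δ + θ)) ≤ 1 + θ + 4 * δ by linarith)
      (show 1 / 2 + (δ + θ / 2 + (δ + θ / 2)) + 1 + -(8 : ℝ) ≤ 1 + θ + 4 * δ by linarith)
    refine hXSMb.trans (h12.trans (le_of_eq ?_))
    rw [hKS]; ring
  -- the error pieces
  set σ : ℝ := 3 / 4 + θ / 2 with hσ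
  have hσδ : σ + 5 * δ ≤ 1 - δ := by rw [hσ, hδ]; linarith
  -- E2
  set E2 : ℝ := 2 * Real.sqrt (emLen T) * A1 * (oscDecayConst k * T / (H * Real.log 2) ^ k)
      + 24 * (Ca * Lm) * Real.sqrt N * T ^ (3 / 4 : ℝ) with hE2
  have hsqrtL : Real.sqrt (emLen T) ≤ 1 * T ^ (3 / 4 : ℝ) := by
    rw [one_mul]
    calc Real.sqrt (emLen T) ≤ Real.sqrt (T ^ (3 / 2 : ℝ)) := Real.sqrt_le_sqrt (emLen_bounds hT0.le).1
      _ = T ^ (3 / 4 : ℝ) := by rw [Real.sqrt_eq_rpow, ← Real.rpow_mul hT0.le]; norm_num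
  have hE2b : E2 ≤ (4 * Ca * oscDecayConst k + 24 * Ca) * T ^ (σ + 5 * δ) := by
    have h1 : 2 * Real.sqrt (emLen T) ≤ 2 * 1 * T ^ (3 / 4 : ℝ) := by linarith
    have h2 : 2 * Real.sqrt (emLen T) * A1 ≤ 2 * 1 * (2 * Ca) * T ^ (3 / 4 + (δ + θ / 2)) :=
      bmul hT0 h1 hA1b hA1_0 (by norm_num)
    have h3 : oscDecayConst k * T / (H * Real.log 2) ^ k ≤ oscDecayConst k * 1 * T ^ (1 + -(8 : ℝ)) := by
      have := hden (oscDecayConst k * T) _ (by positivity) hD2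
      refine this.trans (le_of_eq ?_)
      rw [Real.rpow_add hT0, Real.rpow_one]; ring
    have h4 : 2 * Real.sqrt (emLen T) * A1 * (oscDecayConst k * T / (H * Real.log 2) ^ k)
        ≤ 2 * 1 * (2 * Ca) * (oscDecayConst k * 1) * T ^ (3 / 4 + (δ + θ / 2) + (1 + -(8 : ℝ))) :=
      bmul hT0 h2 h3 (by positivity) (by positivity)
    have h5 : 24 * (Ca * Lm) ≤ 24 * Ca * T ^ δ := by rw [hLm]; exact le_of_eq (by ring)
    have h6 : Real.sqrt N ≤ 1 * T ^ (θ / 2) := by rw [one_mul]; exact hsqrtN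
    have h7 : 24 * (Ca * Lm) * Real.sqrt N ≤ 24 * Ca * 1 * T ^ (δ + θ / 2) := bmul hT0 h5 h6 (Real.sqrt_nonneg _) (by positivity)
    have h8 : T ^ (3 / 4 : ℝ) ≤ 1 * T ^ (3 / 4 : ℝ) := by rw [one_mul]
    have h9 : 24 * (Ca * Lm) * Real.sqrt N * T ^ (3 / 4 : ℝ) ≤ 24 * Ca * 1 * 1 * T ^ (δ + θ / 2 + 3 / 4) :=
      bmul hT0 h7 h8 (by positivity) (by positivity)
    have h10 := badd hT1 h4 h9 (by positivity) (by positivity)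
      (show 3 / 4 + (δ + θ / 2) + (1 + -(8 : ℝ)) ≤ σ + 5 * δ by rw [hσ]; linarith)
      (show δ + θ / 2 + 3 / 4 ≤ σ + 5 * δ by rw [hσ]; linarith)
    refine h10.trans (le_of_eq ?_); ring
  -- E5
  set E5 : ℝ := 4 * Real.sqrt (emLen T) * Real.sqrt Ns * A1 ^ 2
      * (oscDecayConst k * B * T / (H * (1 / (2 * (Ns : ℝ) * N))) ^ k)
      + 12 * T ^ (-(1 / 4 : ℝ)) * (ε₂ / 2 * XSM + ε₂⁻¹ / 2 * XM) with hE5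
  have hs4 : Real.sqrt (Real.sqrt T) = T ^ (1 / 4 : ℝ) := by
    rw [Real.sqrt_eq_rpow, Real.sqrt_eq_rpow, ← Real.rpow_mul hT0.le]; norm_num
  have hsqrtNs : Real.sqrt Ns ≤ 2 * T ^ (1 / 4 : ℝ) := by
    calc Real.sqrt Ns ≤ Real.sqrt (2 * Real.sqrt T) := Real.sqrt_le_sqrt hNsle
      _ = Real.sqrt 2 * T ^ (1 / 4 : ℝ) := by rw [Real.sqrt_mul' _ (Real.sqrt_nonneg _), hs4]
      _ ≤ 2 * T ^ (1 / 4 : ℝ) := by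
          refine mul_le_mul_of_nonneg_right ?_ (Real.rpow_nonneg hT0.le _)
          have h4 : Real.sqrt 4 = 2 := by rw [show (4 : ℝ) = 2 ^ 2 by norm_num, Real.sqrt_sq (by norm_num)]
          calc Real.sqrt 2 ≤ Real.sqrt 4 := Real.sqrt_le_sqrt (by norm_num)
            _ = 2 := h4
  have hE5b : E5 ≤ (32 * Ca ^ 2 * oscDecayConst k * B + 6 * (KS + KM)) * T ^ (σ + 5 * δ) := by
    have h1 : 4 * Real.sqrt (emLen T) ≤ 4 * 1 * T ^ (3 / 4 : ℝ) := by linarith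
    have h2 : 4 * Real.sqrt (emLen T) * Real.sqrt Ns ≤ 4 * 1 * 2 * T ^ ((3 / 4 : ℝ) + 1 / 4) :=
      bmul hT0 h1 hsqrtNs (Real.sqrt_nonneg _) (by norm_num)
    have h3 : A1 ^ 2 ≤ 2 * Ca * (2 * Ca) * T ^ (δ + θ / 2 + (δ + θ / 2)) := by
      rw [sq]; exact bmul hT0 hA1b hA1b hA1_0 (by positivity)
    have h4 : 4 * Real.sqrt (emLen T) * Real.sqrt Ns * A1 ^ 2
        ≤ 4 * 1 * 2 * (2 * Ca * (2 * Ca)) * T ^ ((3 / 4 : ℝ) + 1 / 4 + (δ + θ / 2 + (δ + θ / 2))) :=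
      bmul hT0 h2 h3 (sq_nonneg _) (by norm_num)
    have h5 : oscDecayConst k * B * T / (H * (1 / (2 * (Ns : ℝ) * N))) ^ k ≤ oscDecayConst k * B * 1 * T ^ (1 + -(8 : ℝ)) := by
      have := hden (oscDecayConst k * B * T) _ (by positivity) hDS
      refine this.trans (le_of_eq ?_)
      rw [Real.rpow_add hT0, Real.rpow_one]; ring
    have h6 : 4 * Real.sqrt (emLen T) * Real.sqrt Ns * A1 ^ 2
        * (oscDecayConst k * B * T / (H * (1 / (2 * (Ns : ℝ) * N))) ^ k)
        ≤ 4 * 1 * 2 * (2 * Ca * (2 * Ca)) * (oscDecayConst k * B * 1) * T ^ ((3 / 4 : ℝ) + 1 / 4 + (δ + θ / 2 + (δ + θ / 2)) + (1 + -(8 : ℝ))) :=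
      bmul hT0 h4 h5 (by positivity) (by positivity)
    -- second part: `12 T^{-1/4} (ε₂/2 XSM + ε₂⁻¹/2 XM)`
    have h7 : ε₂ / 2 * XSM ≤ 1 / 2 * KS * T ^ (-(θ / 2) + (1 + θ + 4 * δ)) := by
      have hε : ε₂ / 2 ≤ 1 / 2 * T ^ (-(θ / 2)) := by rw [hε₂]; exact le_of_eq (by ring)
      exact bmul hT0 hε hXSMmono hXSM0 (by norm_num)
    have h8 : ε₂⁻¹ / 2 * XM ≤ 1 / 2 * KM * T ^ (θ / 2 + (1 + 3 * δ)) := by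
      have hε : ε₂⁻¹ / 2 ≤ 1 / 2 * T ^ (θ / 2) := by rw [hε₂inv]; exact le_of_eq (by ring)
      exact bmul hT0 hε hXMmono hXM0 (by norm_num)
    have h9 := badd hT1 h7 h8 (by positivity) (by positivity)
      (show -(θ / 2) + (1 + θ + 4 * δ) ≤ 1 + θ / 2 + 4 * δ by linarith)
      (show θ / 2 + (1 + 3 * δ) ≤ 1 + θ / 2 + 4 * δ by linarith)
    have h10 : 12 * T ^ (-(1 / 4 : ℝ)) ≤ 12 * T ^ (-(1 / 4 : ℝ)) := le_rfl
    have h11 : 12 * T ^ (-(1 / 4 : ℝ)) * (ε₂ / 2 * XSM + ε₂⁻¹ / 2 * XM)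
        ≤ 12 * (1 / 2 * KS + 1 / 2 * KM) * T ^ (-(1 / 4 : ℝ) + (1 + θ / 2 + 4 * δ)) :=
      bmul hT0 h10 h9 (by positivity) (by norm_num)
    have h12 := badd hT1 h6 h11 (by positivity) (by positivity)
      (show (3 / 4 : ℝ) + 1 / 4 + (δ + θ / 2 + (δ + θ / 2)) + (1 + -(8 : ℝ)) ≤ σ + 5 * δ by rw [hσ]; linarith)
      (show -(1 / 4 : ℝ) + (1 + θ / 2 + 4 * δ) ≤ σ + 5 * δ by rw [hσ]; linarith)
    refine h12.trans (le_of_eq ?_); ring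
  -- E6
  set E6 : ℝ := 8 * Real.exp (1 / 6) * T / Real.sqrt (T / (2 * π)) * (A0 * Am) with hE6
  have hE6b : E6 ≤ 30 * Ca ^ 2 * cδ * T ^ (σ + 5 * δ) := by
    have h1 : 8 * Real.exp (1 / 6) * T / Real.sqrt (T / (2 * π)) ≤ 30 * T ^ (1 / 2 : ℝ) := by
      have h2π : Real.sqrt (2 * π) ≤ 3 := by
        rw [show (3 : ℝ) = Real.sqrt 9 by rw [show (9 : ℝ) = 3 ^ 2 by norm_num, Real.sqrt_sq (by norm_num)]]
        exact Real.sqrt_le_sqrt (by linarith [Real.pi_lt_d2])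
      have e : T / Real.sqrt (T / (2 * π)) = Real.sqrt (2 * π) * Real.sqrt T := by
        rw [Real.sqrt_div hT0.le, div_div_eq_mul_div, mul_comm T, mul_div_assoc, Real.div_sqrt]
      calc 8 * Real.exp (1 / 6) * T / Real.sqrt (T / (2 * π))
          = 8 * Real.exp (1 / 6) * (Real.sqrt (2 * π) * Real.sqrt T) := by rw [mul_div_assoc, e]
        _ ≤ 8 * (6 / 5) * (3 * Real.sqrt T) := by
            refine mul_le_mul (mul_le_mul_of_nonneg_left exp_one_sixth_le (by norm_num))
              (mul_le_mul_of_nonneg_right h2π (Real.sqrt_nonneg _)) (by positivity) (by positivity)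
        _ ≤ 30 * T ^ (1 / 2 : ℝ) := by rw [hThalf]; linarith [Real.sqrt_nonneg T]
    have h2 : A0 * Am ≤ Ca * (Ca * cδ) * T ^ (δ + θ + (δ + δ)) := bmul hT0 hA0b hAmb hAm_0 hCa0
    have h3 := bmul hT0 h1 h2 (by positivity) (by norm_num)
    refine h3.trans ?_
    have : 30 * (Ca * (Ca * cδ)) = 30 * Ca ^ 2 * cδ := by ring
    rw [this]
    exact mul_le_mul_of_nonneg_left (Real.rpow_le_rpow_of_exponent_le hT1 (by rw [hσ]; linarith)) (by positivity)
  -- the pieces P4..P8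
  have hP4b : supE * W ≤ |CA| * cδ * 1 * T ^ (δ + -(1 / 4 : ℝ) + 1) := bmul hT0 hsupEb hWb hW0 (by positivity)
  have hP5b : supE * XM * (1 + ε₂⁻¹) ≤ |CA| * cδ * KM * 2 * T ^ (δ + -(1 / 4 : ℝ) + (1 + 3 * δ) + θ / 2) := by
    have h1 : supE * XM ≤ |CA| * cδ * KM * T ^ (δ + -(1 / 4 : ℝ) + (1 + 3 * δ)) := bmul hT0 hsupEb hXMmono hXM0 (by positivity)
    have h2 : 1 + ε₂⁻¹ ≤ 2 * T ^ (θ / 2) := by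
      rw [hε₂inv]; linarith [Real.one_le_rpow hT1 (by linarith : 0 ≤ θ / 2)]
    exact bmul hT0 h1 h2 (by positivity) (by positivity)
  have hP6b : supE * ε₂ * XSM ≤ |CA| * cδ * 1 * KS * T ^ (δ + -(1 / 4 : ℝ) + -(θ / 2) + (1 + θ + 4 * δ)) := by
    have h1 : ε₂ ≤ 1 * T ^ (-(θ / 2)) := by rw [one_mul]
    have h2 : supE * ε₂ ≤ |CA| * cδ * 1 * T ^ (δ + -(1 / 4 : ℝ) + -(θ / 2)) := bmul hT0 hsupEb h1 hε₂0.le (by positivity)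
    exact bmul hT0 h2 hXSMmono hXSM0 (by positivity)
  have hP7b : ε₃ * (2 * W + 8 * XSM) ≤ 1 * (2 * 1 + 8 * KS) * T ^ (-(1 / 4 + θ / 2) + (1 + θ + 4 * δ)) := by
    have h1 : ε₃ ≤ 1 * T ^ (-(1 / 4 + θ / 2)) := by rw [one_mul]
    have h2 : 2 * W ≤ 2 * 1 * T ^ (1 : ℝ) := by rw [Real.rpow_one]; linarith
    have h3 : 8 * XSM ≤ 8 * KS * T ^ (1 + θ + 4 * δ) := by
      have := mul_le_mul_of_nonneg_left hXSMmono (by norm_num : (0 : ℝ) ≤ 8); linarith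
    have h4 := badd hT1 h2 h3 (by norm_num) (by positivity)
      (show (1 : ℝ) ≤ 1 + θ + 4 * δ by linarith) le_rfl
    exact bmul hT0 h1 h4 (by positivity) zero_le_one
  have hP8b : ε₃⁻¹ * (supE ^ 2 * XM) ≤ 1 * (CA ^ 2 * cδ ^ 2 * KM)
      * T ^ (1 / 4 + θ / 2 + (δ + -(1 / 4 : ℝ) + (δ + -(1 / 4 : ℝ)) + (1 + 3 * δ))) := by
    have h1 : ε₃⁻¹ ≤ 1 * T ^ (1 / 4 + θ / 2) := by rw [hε₃inv, one_mul]
    have h2raw : supE * supE ≤ |CA| * cδ * (|CA| * cδ) * T ^ (δ + -(1 / 4 : ℝ) + (δ + -(1 / 4 : ℝ))) :=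
      bmul hT0 hsupEb hsupEb hsupE0 (by positivity)
    have h2 : supE ^ 2 ≤ CA ^ 2 * cδ ^ 2 * T ^ (δ + -(1 / 4 : ℝ) + (δ + -(1 / 4 : ℝ))) := by
      rw [sq, show CA ^ 2 * cδ ^ 2 = |CA| * cδ * (|CA| * cδ) by rw [← sq_abs CA]; ring]
      exact h2raw
    have h3 : supE ^ 2 * XM ≤ CA ^ 2 * cδ ^ 2 * KM * T ^ (δ + -(1 / 4 : ℝ) + (δ + -(1 / 4 : ℝ)) + (1 + 3 * δ)) :=
      bmul hT0 h2 hXMmono hXM0 (by positivity)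
    exact bmul hT0 h1 h3 (by positivity) zero_le_one
  -- everything `≤ Ktot T^{1-δ}` hence `≤ εT/16`
  have hKtot : Kt = 2 * (4 * Ca * oscDecayConst k + 24 * Ca) + 2 * (32 * Ca ^ 2 * oscDecayConst k * B + 6 * (KS + KM))
      + 30 * Ca ^ 2 * cδ + |CA| * cδ + 2 * |CA| * cδ * KM + |CA| * cδ * KS + (2 + 8 * KS) + CA ^ 2 * cδ ^ 2 * KM := by
    rw [hKt, hKM, hKS, hcδ]
  have piece : ∀ {P K e : ℝ}, P ≤ K * T ^ e → 0 ≤ K → K ≤ Kt → e ≤ 1 - δ → P ≤ ε * T / 16 := by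
    intro P K e hP hK hKle he
    have h1 : P ≤ Kt * T ^ (1 - δ) :=
      (bmono hT1 hP hK he).trans (mul_le_mul_of_nonneg_right hKle (Real.rpow_nonneg hT0.le _))
    exact final_piece h1 hT0 hε hlarge
  have t1 : 0 ≤ 2 * (4 * Ca * oscDecayConst k + 24 * Ca) := by positivity
  have t2 : 0 ≤ 2 * (32 * Ca ^ 2 * oscDecayConst k * B + 6 * (KS + KM)) := by positivity
  have t3 : 0 ≤ 30 * Ca ^ 2 * cδ := by positivity
  have t4 : 0 ≤ |CA| * cδ := by positivity
  have t5 : 0 ≤ 2 * |CA| * cδ * KM := by positivity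
  have t6 : 0 ≤ |CA| * cδ * KS := by positivity
  have t7 : 0 ≤ 2 + 8 * KS := by positivity
  have t8 : 0 ≤ CA ^ 2 * cδ ^ 2 * KM := by positivity
  have hP1 : 2 * E2 ≤ ε * T / 16 := by
    refine piece (P := 2 * E2) (K := 2 * (4 * Ca * oscDecayConst k + 24 * Ca)) (e := σ + 5 * δ) (by linarith)
      t1 ?_ hσδ
    rw [hKtot]; linarith
  have hP2 : 2 * E5 ≤ ε * T / 16 := by
    refine piece (P := 2 * E5) (K := 2 * (32 * Ca ^ 2 * oscDecayConst k * B + 6 * (KS + KM))) (e := σ + 5 * δ)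
      (by linarith) t2 ?_ hσδ
    rw [hKtot]; linarith
  have hP3 : E6 ≤ ε * T / 16 := by
    refine piece hE6b t3 ?_ hσδ
    rw [hKtot]; linarith
  have hP4 : supE * W ≤ ε * T / 16 := by
    refine piece hP4b (by positivity) ?_ (by rw [hδ]; linarith)
    rw [hKtot]; linarith
  have hP5 : supE * XM * (1 + ε₂⁻¹) ≤ ε * T / 16 := by
    refine piece hP5b (by positivity) ?_ (by rw [hδ]; linarith)
    rw [hKtot]; linarith
  have hP6 : supE * ε₂ * XSM ≤ ε * T / 16 := by
    refine piece hP6b (by positivity) ?_ (by rw [hδ]; linarith)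
    rw [hKtot]; linarith
  have hP7 : ε₃ * (2 * W + 8 * XSM) ≤ ε * T / 16 := by
    refine piece hP7b (by positivity) ?_ (by rw [hδ]; linarith)
    rw [hKtot]; linarith
  have hP8 : ε₃⁻¹ * (supE ^ 2 * XM) ≤ ε * T / 16 := by
    refine piece hP8b (by positivity) ?_ (by rw [hδ]; linarith)
    rw [hKtot]; linarith
  -- the numerics hypotheses
  have hI1n : |zI1.re - W| ≤ E2 := by
    rw [ha1, one_mul, hwC] at hI1c
    calc |zI1.re - W| = |(zI1 - ((W : ℝ) : ℂ)).re| := by rw [Complex.sub_re, Complex.ofReal_re]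
      _ ≤ ‖zI1 - ((W : ℝ) : ℂ)‖ := Complex.abs_re_le_norm _
      _ ≤ E2 := hI1c
  have hI2n : |2 * zI2.re - 2 * D.re| ≤ 2 * E5 := by
    rw [← mul_sub, abs_mul, abs_of_pos (by norm_num : (0 : ℝ) < 2), ← Complex.sub_re]
    exact mul_le_mul_of_nonneg_left ((Complex.abs_re_le_norm _).trans hI2c) (by norm_num)
  have hDn : |2 * D.re - Qint| ≤ E6 := hDc
  have hfinal := numerics (Xf := Xf) hθ hε hε1 hη0.le hηε hT0 hW1 hε₃0 hgc hfc hXgc hI1n hEMc hESc hI2n hDn hQc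
    hP1 hP2 hP3 hP4 hP5 hP6 hP7 hP8
  exact hfinal.trans hXfc


/-- Thresholds: `X^{1/p} ≤ T` gives `X ≤ T^p` (`X ≥ 0`, `p > 0`). [folklore] -/
theorem le_rpow_of_root_le {X p T : ℝ} (hX : 0 ≤ X) (hp : 0 < p) (h : X ^ (1 / p) ≤ T) : X ≤ T ^ p := by
  have h0 : 0 ≤ X ^ (1 / p) := Real.rpow_nonneg hX _
  calc X = (X ^ (1 / p)) ^ p := by rw [one_div, Real.rpow_inv_rpow hX hp.ne']
    _ ≤ T ^ p := Real.rpow_le_rpow h0 h hp.le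

end PropBFinal

open PropBFinal PropBMoments Literature.NumberTheory.LFunctions.SelfDualAFE Literature.Analysis.Fourier in
/-- **Radziwiłł's Proposition B, discharged** (BCH-free: smooth self-dual approximate functional
equation, first moments of `ζ` over a smooth dyadic window, and Soundararajan's lower bound for
the quadratic form, rescaled pointwise). For `0 < θ < ½`, every `C`, `ε > 0` there is `T₀` such
that for `T ≥ T₀` and every `a` with `a(1) = 1`, `|a(n)| ≤ C(ε') n^{ε'}` (all `ε' > 0`):
`1/θ − ε ≤ 𝓘(M_θ) = T⁻¹ ∫_T^{2T} |1 − ζ(½+it) M_θ(½+it)|² dt`, `M_θ(s) = ∑_{n ≤ T^θ} a(n) n^{-s}`.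
[cite: Radziwill2012, Prop. B (arXiv:1207.6583, §1 and §7)] -/
theorem Radziwill2012_propB_holds : Radziwill2012_propB := by
  intro θ hθ hθ2 C ε hε
  have hhalf : 0 < 1 / 2 - θ := by linarith
  -- fixed parameters
  obtain ⟨δ, hδ⟩ : ∃ d : ℝ, d = (1 / 2 - θ) / 16 := ⟨_, rfl⟩
  have hδ0 : 0 < δ := by rw [hδ]; positivity
  obtain ⟨ε', hε'⟩ : ∃ e : ℝ, e = min ε (1 / θ) := ⟨_, rfl⟩
  have hε'0 : 0 < ε' := by rw [hε']; exact lt_min hε (by positivity)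
  have hε'ε : ε' ≤ ε := by rw [hε']; exact min_le_left _ _
  have hε'1 : ε' ≤ 1 / θ := by rw [hε']; exact min_le_right _ _
  obtain ⟨η, hη⟩ : ∃ e : ℝ, e = min (1 / 8) (ε' * θ / 16) := ⟨_, rfl⟩
  have hη0 : 0 < η := by rw [hη]; exact lt_min (by norm_num) (by positivity)
  have hη8 : η ≤ 1 / 8 := by rw [hη]; exact min_le_left _ _
  have hηε : 2 * η ≤ ε' * θ / 8 := by
    have : η ≤ ε' * θ / 16 := by rw [hη]; exact min_le_right _ _
    linarith
  obtain ⟨CA, tA, hAFE⟩ := norm_zeta_sub_sdAFE_le (κ := 1 / 6) (by norm_num) (by norm_num)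
  obtain ⟨k, hk⟩ : ∃ k : ℕ, 16 / (1 / 2 - θ) ≤ k := ⟨⌈16 / (1 / 2 - θ)⌉₊, Nat.le_ceil _⟩
  obtain ⟨B, hB0, hBρ⟩ := exists_profile_const (κ := 1 / 6) (by norm_num) k
  obtain ⟨TQ, hTQ⟩ := PropB.bchQuadForm_pointwise_ge hθ (by linarith : θ < 1) (by positivity : 0 < ε' / 4)
  obtain ⟨Ca, hCadef⟩ : ∃ c : ℝ, c = max (C δ) 1 := ⟨_, rfl⟩
  have hCa1 : 1 ≤ Ca := by rw [hCadef]; exact le_max_right _ _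
  have hCa0 : 0 ≤ Ca := by linarith
  obtain ⟨Kt, hKt⟩ : ∃ c : ℝ, c = (2 * (4 * Ca * oscDecayConst k + 24 * Ca)
      + 2 * (32 * Ca ^ 2 * oscDecayConst k * B
          + 6 * ((Ca ^ 2 * (3 / δ) ^ 2 + 32 * Ca ^ 2 * (oscDecayConst k * (2 ^ k * B * B)))
            + (Ca ^ 2 * (3 / δ) + 4 * Ca ^ 2 * oscDecayConst k)))
      + 30 * Ca ^ 2 * (3 / δ)
      + |CA| * (3 / δ)
      + 2 * |CA| * (3 / δ) * (Ca ^ 2 * (3 / δ) + 4 * Ca ^ 2 * oscDecayConst k)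
      + |CA| * (3 / δ) * (Ca ^ 2 * (3 / δ) ^ 2 + 32 * Ca ^ 2 * (oscDecayConst k * (2 ^ k * B * B)))
      + (2 + 8 * (Ca ^ 2 * (3 / δ) ^ 2 + 32 * Ca ^ 2 * (oscDecayConst k * (2 ^ k * B * B))))
      + CA ^ 2 * (3 / δ) ^ 2 * (Ca ^ 2 * (3 / δ) + 4 * Ca ^ 2 * oscDecayConst k)) := ⟨_, rfl⟩
  have hKt0 : 0 ≤ Kt := by
    have := Literature.Analysis.Fourier.oscDecayConst_nonneg k
    rw [hKt]; positivity
  -- the threshold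
  refine ⟨max (max (max (max 16 (1 / η)) (max tA TQ)) (max ((6 / η) ^ (1 / ((1 / 2 - θ) / 2)))
    ((8 : ℝ) ^ (1 / (1 / 2 - θ))))) ((16 * Kt / ε') ^ (1 / δ)), fun T hT a ha1 ha => ?_⟩
  have hT16 : 16 ≤ T := le_trans (by simp) hT
  have hTη : 1 / η ≤ T := le_trans (by simp) hT
  have hTA : tA ≤ T := le_trans (by simp) hT
  have hTQ' : TQ ≤ T := le_trans (by simp) hT
  have hT1 : 1 ≤ T := by linarith
  have hT0 : 0 < T := by linarith
  have hibp : 6 / η ≤ T ^ ((1 / 2 - θ) / 2) :=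
    le_rpow_of_root_le (by positivity) (by positivity) (le_trans (by simp) hT)
  have hsm : 8 ≤ T ^ (1 / 2 - θ) :=
    le_rpow_of_root_le (by norm_num) hhalf (le_trans (by simp) hT)
  have hlarge : 16 * Kt / ε' ≤ T ^ δ :=
    le_rpow_of_root_le (by positivity) hδ0 (le_trans (by simp) hT)
  -- the coefficient bound at the exponent `δ`
  have ha' : ∀ n : ℕ, 1 ≤ n → ‖a n‖ ≤ Ca * (n : ℝ) ^ δ := fun n hn =>
    (ha δ hδ0 n hn).trans (mul_le_mul_of_nonneg_right (by rw [hCadef]; exact le_max_left _ _) (by positivity))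
  -- `sup |E|` on `[T, 2T]`
  have hπ := Real.pi_pos
  have hNs : 6 / 5 * Real.sqrt (2 * T / (2 * π)) ≤ (⌊6 / 5 * Real.sqrt (T / π)⌋₊ + 1 : ℕ) := by
    rw [show 2 * T / (2 * π) = T / π by field_simp]
    push_cast
    linarith [Nat.lt_floor_add_one (6 / 5 * Real.sqrt (T / π))]
  have hE := supE_bound hAFE hT1 hTA hNs
  -- the quadratic form
  have hQ : ∀ t : ℝ, T ≤ t → 1 + 1 / θ - ε' / 4 ≤ bchQuadForm (Real.exp 1 * t / 4) ⌊T ^ θ⌋₊ a :=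
    fun t ht => hTQ T hTQ' t ht a ha1
  -- the estimate
  have hcore := core_at_T hθ hθ2 hε'0 hε'1 hδ hη0 hη8 hηε hk hB0 hBρ hCa1 ha' ha1 hT16 hTη hE hQ hibp hsm hKt hlarge
  -- conclusion
  show 1 / θ - ε ≤ T⁻¹ * ∫ t in T..(2 * T), ‖1 - riemannZeta (1 / 2 + t * I)
    * dirichletMollifier a ⌊T ^ θ⌋₊ (1 / 2 + t * I)‖ ^ 2
  have h1 : 1 / θ - ε' ≤ T⁻¹ * ∫ t in T..(2 * T), ‖1 - riemannZeta (1 / 2 + t * I)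
      * dirichletMollifier a ⌊T ^ θ⌋₊ (1 / 2 + t * I)‖ ^ 2 := by
    rw [← div_eq_inv_mul, le_div_iff₀ hT0]
    have : T * (1 / θ - ε') = (1 / θ - ε') * T := mul_comm _ _
    linarith [hcore]
  linarith


end Literature.Barriers.RiemannHypothesis
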